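import Literature.Analysis.FluidPDE.TaoCascadeZeroScaleSetup
import Literature.Analysis.FluidPDE.TaoCascadeZeroScaleGrowth
import Mathlib.Analysis.Complex.ExponentialBounds
import HarnessLib

/-!
# Tao's cascade ODE, §6.7: the parameter regime, (6.146)–(6.150) in the regime, and the time `t_c`

T. Tao, *Finite time blowup for an averaged three-dimensional Navier–Stokes equation*,
J. Amer. Math. Soc. 29 (2016), 601–674 = arXiv:1402.0290v3, §6.7 (display numbers of arXiv v3;
authoritative locators are the proposition numbers and the quoted displays).

Continuation of `TaoCascadeZeroScaleSetup.lean` (the standing hypotheses `ZeroScale.Context` of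
§6.7: `RescaledHypotheses` + `GoodAt` on `[0, T]` + Lemma 6.9 + Prop. 6.13 bounds, `T = T₂`). This
file fixes once and for all an explicit **parameter regime** (`ZeroScale.Regime`: `K ≥ 10⁶`,
`K ε₀ ≥ 10⁶`, `C₄ ≤ K`, `ε exp(10⁶ K¹⁰) ≤ 1`, `(C₁ + C₂ + C₅ + 1)(1+ε₀)^{-n₀/4} ≤ ε⁴ exp(-10 K¹⁰)`
— a sufficient form of "`K` sufficiently large depending on `ε₀` [and on the constants of (6.53),
(6.116)–(6.117)], `ε` sufficiently small, `n₀` sufficiently large", §6.1/§6.4), bundles it with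
the hypotheses as `ZeroScale.Setting`, and then runs the first half of §6.7 **with every "`O()`"
resolved numerically**:

* (6.146) `|a₀² + b₀² + c₀² + d₀² + a₁² - 1| ≤ K⁻⁸` on `[0, T]` (`Setting.sumSq_bound`);
* (6.147) `√(b₀² + c₀²)(t) ≤ (10⁻⁵ + t + K⁻⁷) ε` (`Setting.sqrt_bc_le`);
* (6.148) `|c₀(t)| ≤ 10⁻⁴ ε² exp(K¹⁰ t (10⁻⁵ + t + K⁻⁷) - K¹⁰/2)` (`Setting.abs_c_zero_le`; with
  the corrected initial bound (6.56) the exponent carries `-1/2` where the source has `-1/4`);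
* **the time `t_c`** ("the supremum of all the times `t ∈ [0, T₂]` for which `|c₀(t')| ≤ K⁻¹⁰ε²`
  for all `0 ≤ t' ≤ t`") as `ZeroScale.tc := maximalTimeP …`, and on `[0, t_c]`:
  (6.149)–(6.150)/(6.155) `√(d₀² + a₁²) ≤ 700 K⁻¹⁰` (`sqrt_da_le`), (6.156)
  `1 - 2K⁻⁸ ≤ a₀ ≤ 1 + K⁻⁸` (`a_zero_bounds`), (6.157) `b₀(t) ≥ -10⁻⁵ε + ε(1 - 5K⁻⁸)t`
  (`b_zero_ge`), `Ẽ₋₁(t) ≤ K⁻²⁰ + 8K⁻¹⁴ t < K⁻¹⁰(1+ε₀)^{2/10}` (`F_negOne_le_tc`,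
  `F_negOne_lt_exit`), the ignition bound
  `c₀(t) ≥ 4·10⁻⁶ ε² exp(K¹⁰(t²/2 - (10⁻⁵ + K⁻⁷)t) - 1.001 K¹⁰)` for `t ≥ 10⁻⁵` (`c_zero_lower`,
  by the landed `c_lower_of_affine_rate`);
* **the exit at `t_c`**: `t_c < 2` (the source's (6.158)), `t_c < T` (each alternative of
  Cor. 6.14 at `T = t_c` is excluded — the step the source summarises as "by definition of
  `t_c`"), `t_c ≥ 1/2` ((6.151)/(6.154), hence `T₂ > 1/2`), and (6.159) `c₀(t_c) = K⁻¹⁰ ε²`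
  (`Setting.tc_lt_two`, `tc_lt_T`, `half_le_tc`, `c_zero_tc`).

Stand-alone versions of (6.146)–(6.151) with free parameters exist in
`TaoCascadeZeroScale.lean` / `…Phase.lean` / `…Early.lean` / `…Quiet.lean` / `…RotorPhase.lean`;
the versions here are their resolution in the regime, which is what the `t_c` bootstrap consumes.

## References

* T. Tao, J. Amer. Math. Soc. 29 (2016), 601–674 = arXiv:1402.0290v3, §6.1 (parameter hierarchy),
  §6.7 (6.145)–(6.159) and the definition of `t_c`. [`Tao2016AveragedNS`]
-/

noncomputable section

open Set MeasureTheory intervalIntegral Filter Topology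

namespace Literature.Analysis.FluidPDE

namespace TaoCascade

namespace ZeroScale

/-! ## The parameter regime used in §6.7 -/

/-- A sufficient set of largeness/smallness conditions on the parameters for the §6.7 argument:
`K` large (absolutely, relative to `1/ε₀` and to the implied constant `C₄` of (6.117)), `ε`
exponentially small in `K`, and `n₀` large relative to everything (through `(1+ε₀)^{-n₀/4}`),
cf. the hierarchy `1 ≪ 1/ε₀ ≪ K ≪ 1/ε ≪ n₀` of §6.1. [cite: Tao2016AveragedNS, §6.1] -/
structure Regime (ε₀ K ε C₁ C₂ C₄ C₅ : ℝ) (n₀ : ℤ) : Prop where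
  K_large : (10 : ℝ) ^ 6 ≤ K
  Kε₀ : (10 : ℝ) ^ 6 ≤ K * ε₀
  C₄_le : C₄ ≤ K
  ε_exp : ε * Real.exp (10 ^ 6 * K ^ 10) ≤ 1
  late : (C₁ + C₂ + C₅ + 1) * (1 + ε₀) ^ (-(n₀ : ℝ) / 4) ≤ ε ^ 4 * Real.exp (-10 * K ^ 10)

section RegimeFacts

variable {ε₀ K ε C₁ C₂ C₃ C₄ C₅ : ℝ} {n₀ N : ℤ} {τ : ℤ → ℝ} {Y : Fin 4 → ℤ → ℝ → ℝ}
  {F : ℤ → ℝ → ℝ} {T : ℝ}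

/-- `x ≤ exp x`. [folklore] -/
theorem le_exp_self (x : ℝ) : x ≤ Real.exp x := by
  have := Real.add_one_le_exp x; linarith

/-- `K ^ n ≤ exp (n K)` for `K ≥ 0`. [folklore] -/
theorem pow_le_exp_mul {K : ℝ} (hK : 0 ≤ K) (n : ℕ) : K ^ n ≤ Real.exp (n * K) := by
  rw [Real.exp_nat_mul]
  exact pow_le_pow_left₀ hK (le_exp_self K) n

/-- `0 < K`. [folklore] -/
theorem Regime.K_pos (hr : Regime ε₀ K ε C₁ C₂ C₄ C₅ n₀) : 0 < K := by
  have := hr.K_large; have : (0:ℝ) < 10 ^ 6 := by norm_num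
  linarith

/-- `1 ≤ K`. [folklore] -/
theorem Regime.one_le_K (hr : Regime ε₀ K ε C₁ C₂ C₄ C₅ n₀) : 1 ≤ K := by
  have := hr.K_large; have : (1:ℝ) ≤ 10 ^ 6 := by norm_num
  linarith

/-- `ε ≤ exp(-10⁶ K¹⁰)`. [folklore] -/
theorem Regime.ε_le_exp (hr : Regime ε₀ K ε C₁ C₂ C₄ C₅ n₀) (hε : 0 < ε) :
    ε ≤ Real.exp (-(10 ^ 6 * K ^ 10)) := by
  have h := hr.ε_exp
  rw [Real.exp_neg, le_inv_comm₀ hε (Real.exp_pos _)]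
  calc Real.exp (10 ^ 6 * K ^ 10) = ε⁻¹ * (ε * Real.exp (10 ^ 6 * K ^ 10)) := by
        field_simp
    _ ≤ ε⁻¹ * 1 := by gcongr
    _ = ε⁻¹ := mul_one _

/-- `K^100 ≤ exp(10⁶ K¹⁰)`, hence `ε ≤ K⁻¹⁰⁰`. [folklore] -/
theorem Regime.K_pow_le_exp (hr : Regime ε₀ K ε C₁ C₂ C₄ C₅ n₀) {n : ℕ} (hn : n ≤ 10 ^ 6) :
    K ^ n ≤ Real.exp (10 ^ 6 * K ^ 10) := by
  have hK := hr.one_le_K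
  calc K ^ n ≤ Real.exp (n * K) := pow_le_exp_mul (by linarith) n
    _ ≤ Real.exp (10 ^ 6 * K ^ 10) := by
        apply Real.exp_le_exp.2
        have h1 : (n : ℝ) ≤ 10 ^ 6 := by exact_mod_cast hn
        have h2 : K ≤ K ^ 10 := by
          calc K = K ^ 1 := (pow_one K).symm
            _ ≤ K ^ 10 := pow_le_pow_right₀ hK (by norm_num)
        have h3 : (0:ℝ) ≤ n := Nat.cast_nonneg n
        nlinarith

/-- `ε ≤ K⁻ⁿ` for `n ≤ 10⁶`. [folklore] -/
theorem Regime.ε_le_inv_K_pow (hr : Regime ε₀ K ε C₁ C₂ C₄ C₅ n₀) (hε : 0 < ε) {n : ℕ}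
    (hn : n ≤ 10 ^ 6) : ε ≤ (K ^ n)⁻¹ := by
  have h := hr.ε_exp
  have hKn : 0 < K ^ n := pow_pos hr.K_pos n
  rw [le_inv_comm₀ hε hKn]
  calc K ^ n ≤ Real.exp (10 ^ 6 * K ^ 10) := hr.K_pow_le_exp hn
    _ = ε⁻¹ * (ε * Real.exp (10 ^ 6 * K ^ 10)) := by field_simp
    _ ≤ ε⁻¹ * 1 := by gcongr
    _ = ε⁻¹ := mul_one _

/-- `ε ≤ 1`. [folklore] -/
theorem Regime.ε_le_one (hr : Regime ε₀ K ε C₁ C₂ C₄ C₅ n₀) (hε : 0 < ε) : ε ≤ 1 := by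
  have := hr.ε_le_inv_K_pow hε (n := 0) (by norm_num)
  simpa using this

/-- `K⁻ᵐ ≤ K⁻ⁿ` for `n ≤ m`. [folklore] -/
theorem Regime.inv_pow_anti (hr : Regime ε₀ K ε C₁ C₂ C₄ C₅ n₀) {n m : ℕ} (h : n ≤ m) :
    (K ^ m)⁻¹ ≤ (K ^ n)⁻¹ :=
  inv_anti₀ (pow_pos hr.K_pos n) (pow_le_pow_right₀ hr.one_le_K h)

/-- `c K⁻⁽ⁿ⁺¹⁾ ≤ K⁻ⁿ` for `0 ≤ c ≤ K`. [folklore] -/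
theorem Regime.mul_inv_pow_succ_le (hr : Regime ε₀ K ε C₁ C₂ C₄ C₅ n₀) {c : ℝ} (hc : c ≤ K)
    (n : ℕ) : c * (K ^ (n + 1))⁻¹ ≤ (K ^ n)⁻¹ := by
  have hK := hr.K_pos
  have hKn : 0 < K ^ n := pow_pos hK n
  rw [pow_succ, mul_inv, ← mul_assoc, mul_comm c, mul_assoc]
  calc (K ^ n)⁻¹ * (c * K⁻¹) ≤ (K ^ n)⁻¹ * 1 := by
        gcongr
        rw [mul_inv_le_iff₀ hK]; linarith
    _ = (K ^ n)⁻¹ := mul_one _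

/-- The late-constant terms: `C₁ (1+ε₀)^{-n₀/2} ≤ ε⁴ exp(-10 K¹⁰)` etc. First `(1+ε₀)^{-n₀/4} ≤ 1`. [folklore] -/
theorem Regime.q_n₀_quarter_le (hr : Regime ε₀ K ε C₁ C₂ C₄ C₅ n₀) (hε₀ : 0 < ε₀)
    (hC₁ : 0 ≤ C₁) (hC₂ : 0 ≤ C₂) (hC₅ : 0 ≤ C₅) :
    (1 + ε₀) ^ (-(n₀ : ℝ) / 4) ≤ ε ^ 4 * Real.exp (-10 * K ^ 10) := by
  have h := hr.late
  have h0 : 0 ≤ (1 + ε₀) ^ (-(n₀ : ℝ) / 4) := Real.rpow_nonneg (by linarith) _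
  calc (1 + ε₀) ^ (-(n₀ : ℝ) / 4) ≤ (C₁ + C₂ + C₅ + 1) * (1 + ε₀) ^ (-(n₀ : ℝ) / 4) := by
        nlinarith
    _ ≤ _ := h

/-- `ε⁴ exp(-10K¹⁰) ≤ 1`. [folklore] -/
theorem Regime.late_small (hr : Regime ε₀ K ε C₁ C₂ C₄ C₅ n₀) (hε : 0 < ε) :
    ε ^ 4 * Real.exp (-10 * K ^ 10) ≤ 1 := by
  have h1 : ε ^ 4 ≤ 1 := pow_le_one₀ hε.le (hr.ε_le_one hε)
  have h2 : Real.exp (-10 * K ^ 10) ≤ 1 := by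
    rw [Real.exp_le_one_iff]; have := pow_nonneg hr.K_pos.le 10; linarith
  calc ε ^ 4 * Real.exp (-10 * K ^ 10) ≤ 1 * 1 := by gcongr
    _ = 1 := one_mul 1

/-- `(1+ε₀)^{-n₀/4} ≤ 1`. [folklore] -/
theorem Regime.q_quarter_le_one (hr : Regime ε₀ K ε C₁ C₂ C₄ C₅ n₀) (hε₀ : 0 < ε₀) (hε : 0 < ε)
    (hC₁ : 0 ≤ C₁) (hC₂ : 0 ≤ C₂) (hC₅ : 0 ≤ C₅) : (1 + ε₀) ^ (-(n₀ : ℝ) / 4) ≤ 1 :=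
  (hr.q_n₀_quarter_le hε₀ hC₁ hC₂ hC₅).trans (hr.late_small hε)

/-- `(1+ε₀)^{-n₀/2} ≤ (1+ε₀)^{-n₀/4}`. [folklore] -/
theorem Regime.q_half_le_quarter (hr : Regime ε₀ K ε C₁ C₂ C₄ C₅ n₀) (hε₀ : 0 < ε₀) (hε : 0 < ε)
    (hC₁ : 0 ≤ C₁) (hC₂ : 0 ≤ C₂) (hC₅ : 0 ≤ C₅) :
    (1 + ε₀) ^ (-(n₀ : ℝ) / 2) ≤ (1 + ε₀) ^ (-(n₀ : ℝ) / 4) := by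
  have h1 := hr.q_quarter_le_one hε₀ hε hC₁ hC₂ hC₅
  have h0 : 0 ≤ (1 + ε₀) ^ (-(n₀ : ℝ) / 4) := Real.rpow_nonneg (by linarith) _
  have : (1 + ε₀) ^ (-(n₀ : ℝ) / 2) = (1 + ε₀) ^ (-(n₀ : ℝ) / 4) * (1 + ε₀) ^ (-(n₀ : ℝ) / 4) := by
    rw [← Real.rpow_add (by linarith)]; congr 1; ring
  rw [this]
  calc (1 + ε₀) ^ (-(n₀ : ℝ) / 4) * (1 + ε₀) ^ (-(n₀ : ℝ) / 4)
      ≤ (1 + ε₀) ^ (-(n₀ : ℝ) / 4) * 1 := by gcongr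
    _ = _ := mul_one _

/-- `C (1+ε₀)^{-n₀/2} ≤ ε⁴ exp(-10 K¹⁰)` for each `0 ≤ C ≤ C₁ + C₂ + C₅ + 1`. [folklore] -/
theorem Regime.C_late (hr : Regime ε₀ K ε C₁ C₂ C₄ C₅ n₀) (hε₀ : 0 < ε₀) (hε : 0 < ε)
    (hC₁ : 0 ≤ C₁) (hC₂ : 0 ≤ C₂) (hC₅ : 0 ≤ C₅) {C : ℝ} (hC : 0 ≤ C)
    (hCle : C ≤ C₁ + C₂ + C₅ + 1) :
    C * (1 + ε₀) ^ (-(n₀ : ℝ) / 2) ≤ ε ^ 4 * Real.exp (-10 * K ^ 10) := by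
  have h := hr.late
  have h0 : 0 ≤ (1 + ε₀) ^ (-(n₀ : ℝ) / 4) := Real.rpow_nonneg (by linarith) _
  have hq := hr.q_half_le_quarter hε₀ hε hC₁ hC₂ hC₅
  calc C * (1 + ε₀) ^ (-(n₀ : ℝ) / 2) ≤ C * (1 + ε₀) ^ (-(n₀ : ℝ) / 4) := by gcongr
    _ ≤ (C₁ + C₂ + C₅ + 1) * (1 + ε₀) ^ (-(n₀ : ℝ) / 4) := by gcongr
    _ ≤ _ := h

/-- `ε⁴ exp(-10K¹⁰) ≤ ε² exp(-K¹⁰) K⁻³⁰` (a convenient weakening). [folklore] -/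
theorem Regime.late_le (hr : Regime ε₀ K ε C₁ C₂ C₄ C₅ n₀) (hε : 0 < ε) :
    ε ^ 4 * Real.exp (-10 * K ^ 10) ≤ ε ^ 3 * Real.exp (-2 * K ^ 10) * (K ^ 30)⁻¹ := by
  have hε1 := hr.ε_le_one hε
  have hK := hr.K_pos
  have h30 : K ^ 30 ≤ Real.exp (8 * K ^ 10) := by
    have h1 : K ^ 30 ≤ Real.exp (30 * K) := pow_le_exp_mul hK.le 30
    refine h1.trans (Real.exp_le_exp.2 ?_)
    have hK6 := hr.K_large
    have h2 : K ^ 2 ≤ K ^ 10 := pow_le_pow_right₀ hr.one_le_K (by norm_num)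
    nlinarith
  have hexp : Real.exp (-10 * K ^ 10) ≤ Real.exp (-2 * K ^ 10) * (K ^ 30)⁻¹ := by
    rw [le_mul_inv_iff₀ (pow_pos hK 30)]
    calc Real.exp (-10 * K ^ 10) * K ^ 30 ≤ Real.exp (-10 * K ^ 10) * Real.exp (8 * K ^ 10) := by
          gcongr
      _ = Real.exp (-2 * K ^ 10) := by rw [← Real.exp_add]; congr 1; ring
  have hε4 : ε ^ 4 ≤ ε ^ 3 := by
    rw [pow_succ]; exact mul_le_of_le_one_right (by positivity) hε1
  calc ε ^ 4 * Real.exp (-10 * K ^ 10) ≤ ε ^ 3 * (Real.exp (-2 * K ^ 10) * (K ^ 30)⁻¹) := by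
        gcongr
    _ = _ := by ring

/-- `ε ≤ K⁻¹⁰⁰`. [folklore] -/
theorem Regime.ε_le_K100 (hr : Regime ε₀ K ε C₁ C₂ C₄ C₅ n₀) (hε : 0 < ε) : ε ≤ (K ^ 100)⁻¹ :=
  hr.ε_le_inv_K_pow hε (by norm_num)

/-- `exp(-K¹⁰/2) ≤ K⁻¹⁰⁰`. [folklore] -/
theorem Regime.exp_half_le (hr : Regime ε₀ K ε C₁ C₂ C₄ C₅ n₀) :
    Real.exp (-K ^ 10 / 2) ≤ (K ^ 100)⁻¹ := by
  have hK := hr.K_pos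
  rw [show -K ^ 10 / 2 = -(K ^ 10 / 2) by ring, Real.exp_neg]
  apply inv_anti₀ (pow_pos hK 100)
  calc K ^ 100 ≤ Real.exp (100 * K) := pow_le_exp_mul hK.le 100
    _ ≤ Real.exp (K ^ 10 / 2) := by
        apply Real.exp_le_exp.2
        have hK6 := hr.K_large
        have h2 : K ^ 2 ≤ K ^ 10 := pow_le_pow_right₀ hr.one_le_K (by norm_num)
        nlinarith

/-- `ε⁴ exp(-10K¹⁰) ≤ ε`. [folklore] -/
theorem Regime.late_le_ε (hr : Regime ε₀ K ε C₁ C₂ C₄ C₅ n₀) (hε : 0 < ε) :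
    ε ^ 4 * Real.exp (-10 * K ^ 10) ≤ ε := by
  have hε1 := hr.ε_le_one hε
  have h1 : ε ^ 4 ≤ ε := by
    calc ε ^ 4 ≤ ε ^ 1 := pow_le_pow_of_le_one hε.le hε1 (by norm_num)
      _ = ε := pow_one ε
  have h2 : Real.exp (-10 * K ^ 10) ≤ 1 := by
    rw [Real.exp_le_one_iff]; have := pow_nonneg hr.K_pos.le 10; linarith
  calc ε ^ 4 * Real.exp (-10 * K ^ 10) ≤ ε * 1 := by gcongr
    _ = ε := mul_one ε

/-- `K⁻⁽ⁿ⁺¹⁾ ≤ 10⁻⁶ K⁻ⁿ`. [folklore] -/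
theorem Regime.inv_pow_succ_le (hr : Regime ε₀ K ε C₁ C₂ C₄ C₅ n₀) (n : ℕ) :
    (K ^ (n + 1))⁻¹ ≤ 1 / 10 ^ 6 * (K ^ n)⁻¹ := by
  have hK := hr.K_pos
  rw [pow_succ, mul_inv, mul_comm ((K ^ n)⁻¹)]
  gcongr
  rw [one_div]; exact inv_anti₀ (by norm_num) hr.K_large

end RegimeFacts

/-! ## The setting of §6.7: hypotheses and parameter regime together -/

/-- The hypotheses of §6.7 (`Context`) together with the parameter regime (`Regime`). [cite: Tao2016AveragedNS, §6.7] -/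
structure Setting (ε₀ K ε C₁ C₂ C₃ C₄ C₅ : ℝ) (n₀ N : ℤ) (τ : ℤ → ℝ) (Y : Fin 4 → ℤ → ℝ → ℝ)
    (F : ℤ → ℝ → ℝ) (T : ℝ) : Prop
    extends Context ε₀ K ε C₁ C₂ C₃ C₄ C₅ n₀ N τ Y F T, Regime ε₀ K ε C₁ C₂ C₄ C₅ n₀

section Transition

variable {ε₀ K ε C₁ C₂ C₃ C₄ C₅ : ℝ} {n₀ N : ℤ} {τ : ℤ → ℝ} {Y : Fin 4 → ℤ → ℝ → ℝ}
  {F : ℤ → ℝ → ℝ} {T : ℝ}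

/-- `ρ := C₁ (1+ε₀)^{-n₀/2} ≤ ε⁴ exp(-10 K¹⁰)`. [cite: Tao2016AveragedNS, §6.7] -/
theorem Setting.ρ_le (hs : Setting ε₀ K ε C₁ C₂ C₃ C₄ C₅ n₀ N τ Y F T) :
    C₁ * (1 + ε₀) ^ (-(n₀ : ℝ) / 2) ≤ ε ^ 4 * Real.exp (-10 * K ^ 10) :=
  hs.C_late hs.ε₀_pos hs.ε_pos hs.C₁_nn hs.C₂_nn hs.C₅_nn hs.C₁_nn
    (by linarith [hs.C₂_nn, hs.C₅_nn])

/-- `C₁ (1+ε₀)^{-n₀/2} ≤ ε`. [cite: Tao2016AveragedNS, §6.7] -/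
theorem Setting.ρ_le_ε (hs : Setting ε₀ K ε C₁ C₂ C₃ C₄ C₅ n₀ N τ Y F T) :
    C₁ * (1 + ε₀) ^ (-(n₀ : ℝ) / 2) ≤ ε :=
  hs.ρ_le.trans (hs.late_le_ε hs.ε_pos)

/-- `ε ≤ K⁻¹⁰⁰`. [cite: Tao2016AveragedNS, §6.7] -/
theorem Setting.ε_le_K100 (hs : Setting ε₀ K ε C₁ C₂ C₃ C₄ C₅ n₀ N τ Y F T) :
    ε ≤ (K ^ 100)⁻¹ := hs.toRegime.ε_le_K100 hs.ε_pos

/-- **The derivative of `S = a₀² + b₀² + c₀² + d₀² + a₁²`** (for (6.146)): on `[0, T]`,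
`|∂ₜS| ≤ 13 K⁻⁹`. [cite: Tao2016AveragedNS, §6.7 before (6.146)] -/
theorem Setting.dS_le (hs : Setting ε₀ K ε C₁ C₂ C₃ C₄ C₅ n₀ N τ Y F T) {t : ℝ}
    (ht : t ∈ Icc 0 T) :
    |2 * (Y 0 0 t * dY (τ (n₀ - N)) Y 0 0 t + Y 1 0 t * dY (τ (n₀ - N)) Y 1 0 t +
        Y 2 0 t * dY (τ (n₀ - N)) Y 2 0 t + Y 3 0 t * dY (τ (n₀ - N)) Y 3 0 t +
        Y 0 1 t * dY (τ (n₀ - N)) Y 0 1 t)| ≤ 13 * (K ^ 9)⁻¹ := by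
  have hra := hs.da_zero ht
  have hrb := hs.db_zero ht
  have hrc := hs.dc_zero ht
  have hrd := hs.dd_zero ht
  have hr1 := hs.da_one ht
  set a := Y 0 0 t; set b := Y 1 0 t; set c := Y 2 0 t; set d := Y 3 0 t; set a₁ := Y 0 1 t
  set Da := dY (τ (n₀ - N)) Y 0 0 t; set Db := dY (τ (n₀ - N)) Y 1 0 t
  set Dc := dY (τ (n₀ - N)) Y 2 0 t; set Dd := dY (τ (n₀ - N)) Y 3 0 t
  set D1 := dY (τ (n₀ - N)) Y 0 1 t
  set ρ := C₁ * (1 + ε₀) ^ (-(n₀ : ℝ) / 2)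
  set q52 := (1 + ε₀) ^ ((5 : ℝ) / 2)
  -- residuals
  set ra := Da + (ε ^ 2)⁻¹ * c * d
  set rb := Db - (ε * a ^ 2 - ε⁻¹ * K ^ 10 * c ^ 2)
  set rc := Dc - (ε ^ 2 * Real.exp (-K ^ 10) * a ^ 2 + ε⁻¹ * K ^ 10 * b * c)
  set rd := Dd - ((ε ^ 2)⁻¹ * c * a - q52 * K * d * a₁)
  set r1 := D1 - q52 * K * d ^ 2
  have key : 2 * (a * Da + b * Db + c * Dc + d * Dd + a₁ * D1) =
      2 * (a * ra + b * rb + c * rc + d * rd + a₁ * r1 + ε * a ^ 2 * b +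
        ε ^ 2 * Real.exp (-K ^ 10) * a ^ 2 * c) := by
    simp only [ra, rb, rc, rd, r1]; ring
  rw [key]
  -- sizes
  have ha := hs.abs_Y_zero_le 0 ht
  have hb := hs.abs_Y_zero_le 1 ht
  have hc := hs.abs_Y_zero_le 2 ht
  have hd := hs.abs_Y_zero_le 3 ht
  have ha1 := hs.abs_Y_one_le 0 ht
  have ha2 := hs.sq_Y_zero_le 0 ht
  have hK := hs.K_pos
  have hε := hs.ε_pos
  have hεK := hs.ε_le_K100
  have hρε := hs.ρ_le_ε
  have hρ0 : 0 ≤ ρ := mul_nonneg hs.C₁_nn (Real.rpow_nonneg hs.q_pos.le _)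
  have hF1 := hs.F_negOne_le ht
  have hC₄ := hs.C₄_nn
  have hC₄K := hs.C₄_le
  have hexph := hs.exp_half_le
  have hexp0 : 0 ≤ Real.exp (-K ^ 10 / 2) := (Real.exp_pos _).le
  have hexp1 : Real.exp (-K ^ 10) ≤ 1 := by
    rw [Real.exp_le_one_iff]; have := pow_nonneg hK.le 10; linarith
  have hK100_9 : (K ^ 100)⁻¹ ≤ (K ^ 10)⁻¹ := hs.inv_pow_anti (by norm_num)
  have hK10_9 : (K ^ 10)⁻¹ ≤ 1 / 10 ^ 6 * (K ^ 9)⁻¹ := hs.inv_pow_succ_le 9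
  have hK9 : 0 < (K ^ 9)⁻¹ := by positivity
  have hK10 : 0 < (K ^ 10)⁻¹ := by positivity
  -- |ra| ≤ 5ε + 4 K⁻⁹ + ρ
  have hra' : |ra| ≤ 5 * ε + 4 * (K ^ 9)⁻¹ + ρ := by
    have : 2 * K * F (-1) t ≤ 4 * (K ^ 9)⁻¹ := by
      calc 2 * K * F (-1) t ≤ 2 * K * (2 * (K ^ 10)⁻¹) := by gcongr
        _ = 4 * (K ^ 9)⁻¹ := by field_simp; ring
    linarith
  -- |r1| ≤ 16 C₄ ε² (3/2) + 4 C₄ e^{-K¹⁰/2} K⁻¹⁰ + 4ρ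
  have hr1' : |r1| ≤ 24 * (K * ε ^ 2) + 4 * (K * Real.exp (-K ^ 10 / 2) * (K ^ 10)⁻¹) + 4 * ρ := by
    have e1 : 16 * C₄ * ε ^ 2 * |a₁| ≤ 16 * K * ε ^ 2 * (3 / 2) := by gcongr
    have e2 : 4 * C₄ * Real.exp (-K ^ 10 / 2) * (K ^ 10)⁻¹ ≤
        4 * K * Real.exp (-K ^ 10 / 2) * (K ^ 10)⁻¹ := by gcongr
    have h := hr1
    simp only [ρ]
    linarith
  -- each product
  have p1 : |a * ra| ≤ 3 / 2 * (5 * ε + 4 * (K ^ 9)⁻¹ + ρ) := by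
    rw [abs_mul]; exact mul_le_mul ha hra' (abs_nonneg _) (by norm_num)
  have p2 : |b * rb| ≤ 3 / 2 * ρ := by
    rw [abs_mul]; exact mul_le_mul hb hrb (abs_nonneg _) (by norm_num)
  have p3 : |c * rc| ≤ 3 / 2 * ρ := by
    rw [abs_mul]; exact mul_le_mul hc hrc (abs_nonneg _) (by norm_num)
  have p4 : |d * rd| ≤ 3 / 2 * ρ := by
    rw [abs_mul]; exact mul_le_mul hd hrd (abs_nonneg _) (by norm_num)
  have p5 : |a₁ * r1| ≤
      3 / 2 * (24 * (K * ε ^ 2) + 4 * (K * Real.exp (-K ^ 10 / 2) * (K ^ 10)⁻¹) + 4 * ρ) := by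
    rw [abs_mul]; exact mul_le_mul ha1 hr1' (abs_nonneg _) (by norm_num)
  have p6 : |ε * a ^ 2 * b| ≤ 3 * ε := by
    rw [abs_mul, abs_mul, abs_of_pos hε, abs_of_nonneg (sq_nonneg a)]
    calc ε * a ^ 2 * |b| ≤ ε * 2 * (3 / 2) := by gcongr
      _ = 3 * ε := by ring
  have p7 : |ε ^ 2 * Real.exp (-K ^ 10) * a ^ 2 * c| ≤ 3 * ε := by
    rw [abs_mul, abs_mul, abs_mul, abs_of_pos (by positivity : (0:ℝ) < ε ^ 2),
      abs_of_pos (Real.exp_pos _), abs_of_nonneg (sq_nonneg a)]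
    have hε1 : ε ^ 2 ≤ ε := by
      have := hs.ε_le_one hε; nlinarith
    calc ε ^ 2 * Real.exp (-K ^ 10) * a ^ 2 * |c| ≤ ε * 1 * 2 * (3 / 2) := by gcongr
      _ = 3 * ε := by ring
  -- tiny terms
  have t1 : K * ε ^ 2 ≤ (K ^ 10)⁻¹ := by
    have hε1 := hs.ε_le_one hε
    calc K * ε ^ 2 ≤ K * ((K ^ 100)⁻¹ * 1) := by
          rw [pow_two]; gcongr
      _ = K * (K ^ 100)⁻¹ := by ring
      _ ≤ (K ^ 99)⁻¹ := hs.mul_inv_pow_succ_le le_rfl 99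
      _ ≤ (K ^ 10)⁻¹ := hs.inv_pow_anti (by norm_num)
  have t2 : K * Real.exp (-K ^ 10 / 2) * (K ^ 10)⁻¹ ≤ (K ^ 10)⁻¹ := by
    have : K * Real.exp (-K ^ 10 / 2) ≤ 1 := by
      calc K * Real.exp (-K ^ 10 / 2) ≤ K * (K ^ 100)⁻¹ := by gcongr
        _ ≤ (K ^ 99)⁻¹ := hs.mul_inv_pow_succ_le le_rfl 99
        _ ≤ (K ^ 0)⁻¹ := hs.inv_pow_anti (by norm_num)
        _ = 1 := by simp
    calc K * Real.exp (-K ^ 10 / 2) * (K ^ 10)⁻¹ ≤ 1 * (K ^ 10)⁻¹ := by gcongr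
      _ = _ := one_mul _
  have t3 : ε ≤ (K ^ 10)⁻¹ := hεK.trans hK100_9
  have t4 : ρ ≤ (K ^ 10)⁻¹ := hρε.trans t3
  rw [abs_mul, abs_two]
  have hsum := abs_add_le (a * ra + b * rb + c * rc + d * rd + a₁ * r1 + ε * a ^ 2 * b)
    (ε ^ 2 * Real.exp (-K ^ 10) * a ^ 2 * c)
  have hsum2 := abs_add_le (a * ra + b * rb + c * rc + d * rd + a₁ * r1) (ε * a ^ 2 * b)
  have hsum3 := abs_add_le (a * ra + b * rb + c * rc + d * rd) (a₁ * r1)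
  have hsum4 := abs_add_le (a * ra + b * rb + c * rc) (d * rd)
  have hsum5 := abs_add_three (a * ra) (b * rb) (c * rc)
  linarith

/-- The sum of squares `S = a₀² + b₀² + c₀² + d₀² + a₁²`. [cite: Tao2016AveragedNS, §6.7] -/
def sumSq (Y : Fin 4 → ℤ → ℝ → ℝ) (t : ℝ) : ℝ :=
  Y 0 0 t ^ 2 + Y 1 0 t ^ 2 + Y 2 0 t ^ 2 + Y 3 0 t ^ 2 + Y 0 1 t ^ 2

/-- The right derivative of `S = a₀² + b₀² + c₀² + d₀² + a₁²`. [cite: Tao2016AveragedNS, §6.7] -/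
theorem Setting.hasDerivWithinAt_sumSq (hs : Setting ε₀ K ε C₁ C₂ C₃ C₄ C₅ n₀ N τ Y F T) {t : ℝ}
    (ht : τ (n₀ - N) ≤ t) :
    HasDerivWithinAt (sumSq Y)
      (2 * (Y 0 0 t * dY (τ (n₀ - N)) Y 0 0 t + Y 1 0 t * dY (τ (n₀ - N)) Y 1 0 t +
        Y 2 0 t * dY (τ (n₀ - N)) Y 2 0 t + Y 3 0 t * dY (τ (n₀ - N)) Y 3 0 t +
        Y 0 1 t * dY (τ (n₀ - N)) Y 0 1 t)) (Ici t) t := by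
  have h00 := (hs.hasDerivWithinAt_Y 0 0 ht).pow 2
  have h10 := (hs.hasDerivWithinAt_Y 1 0 ht).pow 2
  have h20 := (hs.hasDerivWithinAt_Y 2 0 ht).pow 2
  have h30 := (hs.hasDerivWithinAt_Y 3 0 ht).pow 2
  have h01 := (hs.hasDerivWithinAt_Y 0 1 ht).pow 2
  have := (((h00.add h10).add h20).add h30).add h01
  refine this.congr_deriv ?_
  norm_num; ring

/-- `S` is continuous. [cite: Tao2016AveragedNS, §6.7] -/
theorem Setting.continuousOn_sumSq (hs : Setting ε₀ K ε C₁ C₂ C₃ C₄ C₅ n₀ N τ Y F T) {a b : ℝ}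
    (ha : τ (n₀ - N) ≤ a) : ContinuousOn (sumSq Y) (Icc a b) := by
  unfold sumSq
  have h := fun i k => (hs.continuousOn_Y i k (b := b) ha).pow 2
  exact ((((h 0 0).add (h 1 0)).add (h 2 0)).add (h 3 0)).add (h 0 1)

/-- **Lemma 6.8** `Ẽ₁(0) ≤ K⁻³⁰` (from (6.66) at `k = 0` if `N > n₀`, from (6.50) if `N = n₀`).
[cite: Tao2016AveragedNS, §6.5 Lemma 6.8] -/
theorem Setting.F_one_zero_le (hs : Setting ε₀ K ε C₁ C₂ C₃ C₄ C₅ n₀ N τ Y F T) :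
    F 1 0 ≤ (K ^ 30)⁻¹ := by
  have hK : 0 ≤ (K ^ 30)⁻¹ := by have := hs.K_pos; positivity
  rcases lt_or_eq_of_le hs.le_N with hN | hN
  · have hτ : τ (0 - 1) ≤ 0 := by
      have := hs.hyp.tau_lt 0 (by linarith) le_rfl
      rw [hs.hyp.tau_zero] at this; exact this.le
    have h := hs.hyp.en_after 0 (by linarith) le_rfl 1 le_rfl 0 ⟨hτ, by rw [hs.hyp.tau_zero]⟩
    have hq : (1 + ε₀) ^ (-(10 : ℝ) * ((1 : ℕ) : ℝ) + |((0 : ℤ) : ℝ) - 1| / 50) ≤ 1 :=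
      hs.q_rpow_le_one (by norm_num)
    calc F 1 0 = F (0 + (1 : ℕ)) 0 := by norm_num
      _ ≤ (K ^ 30)⁻¹ * (1 + ε₀) ^ (-(10 : ℝ) * ((1 : ℕ) : ℝ) + |((0 : ℤ) : ℝ) - 1| / 50) := h
      _ ≤ (K ^ 30)⁻¹ * 1 := by gcongr
      _ = _ := mul_one _
  · have h := hs.hyp.init_F 1 (by omega)
    rw [show n₀ - N = 0 by omega, hs.hyp.tau_zero] at h
    rw [h]; exact hK

/-- `S(0) = 1 + O(K⁻²⁰)`: precisely `0 ≤ S(0) - 1 ≤ 3 K⁻²⁰`. [cite: Tao2016AveragedNS, §6.7] -/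
theorem Setting.sumSq_zero (hs : Setting ε₀ K ε C₁ C₂ C₃ C₄ C₅ n₀ N τ Y F T) :
    0 ≤ sumSq Y 0 - 1 ∧ sumSq Y 0 - 1 ≤ 3 * (K ^ 20)⁻¹ := by
  have ha := hs.hyp.a_eq
  have hb := hs.hyp.b_abs_le
  have hc := hs.hyp.c_abs_le
  have hd := hs.hyp.d_abs_le
  have ha1 := hs.sq_Y_le 0 1 hs.τ₀_le
  have hF1 := hs.F_one_zero_le
  have hK := hs.K_pos
  have hε := hs.ε_pos
  have hεK := hs.ε_le_K100
  have hK20 : 0 < (K ^ 20)⁻¹ := by positivity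
  have hK30 : (K ^ 30)⁻¹ ≤ (K ^ 20)⁻¹ := hs.inv_pow_anti (by norm_num)
  have hK100 : (K ^ 100)⁻¹ ≤ (K ^ 20)⁻¹ := hs.inv_pow_anti (by norm_num)
  have hγ : 1 / 10 ^ 5 * Real.exp (-K ^ 10 / 2) ≤ 1 := by
    have : Real.exp (-K ^ 10 / 2) ≤ 1 := by
      rw [Real.exp_le_one_iff]; have := pow_nonneg hK.le 10; linarith
    linarith [Real.exp_pos (-K ^ 10 / 2)]
  have hε1 := hs.ε_le_one hε
  -- squares of the small initial modes
  have hhalf : (K ^ 20)⁻¹ ≤ 1 / 2 := hs.inv_K_pow_le_half (by norm_num)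
  have hb2 : Y 1 0 0 ^ 2 ≤ 1 / 2 * (K ^ 20)⁻¹ := by
    have h1 : |Y 1 0 0| ≤ (K ^ 20)⁻¹ := by
      calc |Y 1 0 0| ≤ 1 / 10 ^ 5 * ε := hb
        _ ≤ 1 * (K ^ 100)⁻¹ := by gcongr; norm_num
        _ ≤ (K ^ 20)⁻¹ := by rw [one_mul]; exact hK100
    have h2 := pow_le_pow_left₀ (abs_nonneg _) h1 2
    rw [sq_abs] at h2
    calc Y 1 0 0 ^ 2 ≤ (K ^ 20)⁻¹ ^ 2 := h2
      _ = (K ^ 20)⁻¹ * (K ^ 20)⁻¹ := sq _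
      _ ≤ 1 / 2 * (K ^ 20)⁻¹ := by gcongr
  have hc2 : Y 2 0 0 ^ 2 ≤ 1 / 2 * (K ^ 20)⁻¹ := by
    have h1 : |Y 2 0 0| ≤ (K ^ 20)⁻¹ := by
      calc |Y 2 0 0| ≤ 1 / 10 ^ 5 * Real.exp (-K ^ 10 / 2) * ε ^ 2 := hc
        _ ≤ 1 * ε ^ 2 := by gcongr
        _ ≤ ε := by rw [one_mul]; nlinarith
        _ ≤ (K ^ 20)⁻¹ := hεK.trans hK100
    have h2 := pow_le_pow_left₀ (abs_nonneg _) h1 2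
    rw [sq_abs] at h2
    calc Y 2 0 0 ^ 2 ≤ (K ^ 20)⁻¹ ^ 2 := h2
      _ = (K ^ 20)⁻¹ * (K ^ 20)⁻¹ := sq _
      _ ≤ 1 / 2 * (K ^ 20)⁻¹ := by gcongr
  have hd2 : Y 3 0 0 ^ 2 ≤ (K ^ 20)⁻¹ := by
    have h2 := pow_le_pow_left₀ (abs_nonneg _) hd 2
    rw [sq_abs] at h2
    calc Y 3 0 0 ^ 2 ≤ (K ^ 10)⁻¹ ^ 2 := h2
      _ = (K ^ 20)⁻¹ := by rw [← inv_pow, ← pow_mul, inv_pow]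
  have ha12 : Y 0 1 0 ^ 2 ≤ 2 / 10 ^ 6 * (K ^ 20)⁻¹ := by
    have h21 : (K ^ 30)⁻¹ ≤ (K ^ 21)⁻¹ := hs.inv_pow_anti (by norm_num)
    have h20 : (K ^ 21)⁻¹ ≤ 1 / 10 ^ 6 * (K ^ 20)⁻¹ := hs.inv_pow_succ_le 20
    linarith
  unfold sumSq
  rw [ha]
  constructor
  · nlinarith [sq_nonneg (Y 1 0 0), sq_nonneg (Y 2 0 0), sq_nonneg (Y 3 0 0),
      sq_nonneg (Y 0 1 0)]
  · linarith

/-- **(6.146)**: `a₀² + b₀² + c₀² + d₀² + a₁² = 1 + O(K⁻¹)` on `[0, T]`; precisely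
`|S(t) - 1| ≤ K⁻⁸`. [cite: Tao2016AveragedNS, §6.7 (6.146)] -/
theorem Setting.sumSq_bound (hs : Setting ε₀ K ε C₁ C₂ C₃ C₄ C₅ n₀ N τ Y F T) {t : ℝ}
    (ht : t ∈ Icc 0 T) : |sumSq Y t - 1| ≤ (K ^ 8)⁻¹ := by
  have hderiv := abs_sub_le_mul_of_abs_deriv_le (hs.continuousOn_sumSq (b := T) hs.τ₀_le)
    (fun x hx => hs.hasDerivWithinAt_sumSq (hs.τ₀_le.trans hx.1))
    (fun x hx => hs.dS_le (Ico_subset_Icc_self hx)) ht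
  obtain ⟨h0, h1⟩ := hs.sumSq_zero
  have hK := hs.K_pos
  have hT := hs.T_le
  have h9 : (K ^ 9)⁻¹ ≤ 1 / 10 ^ 6 * (K ^ 8)⁻¹ := hs.inv_pow_succ_le 8
  have h20 : (K ^ 20)⁻¹ ≤ (K ^ 9)⁻¹ := hs.inv_pow_anti (by norm_num)
  have h8 : 0 < (K ^ 8)⁻¹ := by positivity
  have ht100 : t - 0 ≤ 100 := by linarith [ht.2]
  have : 13 * (K ^ 9)⁻¹ * (t - 0) ≤ 13 * (K ^ 9)⁻¹ * 100 := by gcongr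
  rw [abs_le] at hderiv ⊢
  constructor <;> nlinarith

/-- `a₀² ≤ 1 + K⁻⁸` on `[0, T]` (from (6.146)). [cite: Tao2016AveragedNS, §6.7] -/
theorem Setting.sq_a_zero_le (hs : Setting ε₀ K ε C₁ C₂ C₃ C₄ C₅ n₀ N τ Y F T) {t : ℝ}
    (ht : t ∈ Icc 0 T) : Y 0 0 t ^ 2 ≤ 1 + (K ^ 8)⁻¹ := by
  have h := hs.sumSq_bound ht
  rw [abs_le] at h
  unfold sumSq at h
  nlinarith [sq_nonneg (Y 1 0 t), sq_nonneg (Y 2 0 t), sq_nonneg (Y 3 0 t), sq_nonneg (Y 0 1 t)]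

/-- **(6.147)**: `√(b₀² + c₀²)(t) ≤ (10⁻⁵ + t + K⁻⁷) ε` on `[0, T]` (the printed
`(10⁻⁵ + t + O(K⁻¹)) ε`). [cite: Tao2016AveragedNS, §6.7 (6.147)] -/
theorem Setting.sqrt_bc_le (hs : Setting ε₀ K ε C₁ C₂ C₃ C₄ C₅ n₀ N τ Y F T) {t : ℝ}
    (ht : t ∈ Icc 0 T) :
    Real.sqrt (Y 1 0 t ^ 2 + Y 2 0 t ^ 2) ≤ (1 / 10 ^ 5 + t + (K ^ 7)⁻¹) * ε := by
  have hK := hs.K_pos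
  have hε := hs.ε_pos
  have hε1 := hs.ε_le_one hε
  have hεK := hs.ε_le_K100
  have hρε := hs.ρ_le
  have hK8 : 0 < (K ^ 8)⁻¹ := by positivity
  set M : ℝ := ε * (1 + 2 * (K ^ 8)⁻¹) with hM
  have hM0 : 0 ≤ M := by positivity
  -- the differential inequality
  have hbound : ∀ x ∈ Ico 0 T,
      Y 1 0 x * dY (τ (n₀ - N)) Y 1 0 x + Y 2 0 x * dY (τ (n₀ - N)) Y 2 0 x ≤
        M * Real.sqrt (Y 1 0 x ^ 2 + Y 2 0 x ^ 2) + 0 * (Y 1 0 x ^ 2 + Y 2 0 x ^ 2) := by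
    intro x hx
    have hx' : x ∈ Icc 0 T := Ico_subset_Icc_self hx
    have hrb := hs.db_zero hx'
    have hrc := hs.dc_zero hx'
    have ha2 := hs.sq_a_zero_le hx'
    set a := Y 0 0 x; set b := Y 1 0 x; set c := Y 2 0 x
    set Db := dY (τ (n₀ - N)) Y 1 0 x; set Dc := dY (τ (n₀ - N)) Y 2 0 x
    set ρ := C₁ * (1 + ε₀) ^ (-(n₀ : ℝ) / 2)
    set rb := Db - (ε * a ^ 2 - ε⁻¹ * K ^ 10 * c ^ 2)
    set rc := Dc - (ε ^ 2 * Real.exp (-K ^ 10) * a ^ 2 + ε⁻¹ * K ^ 10 * b * c)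
    have key : b * Db + c * Dc =
        b * rb + c * rc + ε * a ^ 2 * b + ε ^ 2 * Real.exp (-K ^ 10) * a ^ 2 * c := by
      simp only [rb, rc]; ring
    rw [key, zero_mul, add_zero]
    set r := Real.sqrt (b ^ 2 + c ^ 2)
    have hbr : |b| ≤ r := Real.abs_le_sqrt (by nlinarith)
    have hcr : |c| ≤ r := Real.abs_le_sqrt (by nlinarith)
    have hr0 : 0 ≤ r := Real.sqrt_nonneg _
    have hρ0 : 0 ≤ ρ := mul_nonneg hs.C₁_nn (Real.rpow_nonneg hs.q_pos.le _)
    have hexp1 : Real.exp (-K ^ 10) ≤ 1 := by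
      rw [Real.exp_le_one_iff]; have := pow_nonneg hK.le 10; linarith
    have hexp0 := Real.exp_pos (-K ^ 10)
    -- bound each term by r * (…)
    have e1 : b * rb ≤ r * ρ := by
      calc b * rb ≤ |b * rb| := le_abs_self _
        _ = |b| * |rb| := abs_mul _ _
        _ ≤ r * ρ := mul_le_mul hbr hrb (abs_nonneg _) hr0
    have e2 : c * rc ≤ r * ρ := by
      calc c * rc ≤ |c * rc| := le_abs_self _
        _ = |c| * |rc| := abs_mul _ _
        _ ≤ r * ρ := mul_le_mul hcr hrc (abs_nonneg _) hr0
    have e3 : ε * a ^ 2 * b ≤ r * (ε * (1 + (K ^ 8)⁻¹)) := by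
      calc ε * a ^ 2 * b ≤ |ε * a ^ 2 * b| := le_abs_self _
        _ = ε * a ^ 2 * |b| := by rw [abs_mul, abs_mul, abs_of_pos hε, abs_of_nonneg (sq_nonneg a)]
        _ ≤ ε * (1 + (K ^ 8)⁻¹) * r := by gcongr
        _ = r * (ε * (1 + (K ^ 8)⁻¹)) := by ring
    have e4 : ε ^ 2 * Real.exp (-K ^ 10) * a ^ 2 * c ≤ r * (ε ^ 2 * (1 + (K ^ 8)⁻¹)) := by
      calc ε ^ 2 * Real.exp (-K ^ 10) * a ^ 2 * c ≤ |ε ^ 2 * Real.exp (-K ^ 10) * a ^ 2 * c| :=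
            le_abs_self _
        _ = ε ^ 2 * Real.exp (-K ^ 10) * a ^ 2 * |c| := by
            rw [abs_mul, abs_mul, abs_mul, abs_of_pos (by positivity : (0:ℝ) < ε ^ 2),
              abs_of_pos hexp0, abs_of_nonneg (sq_nonneg a)]
        _ ≤ ε ^ 2 * 1 * (1 + (K ^ 8)⁻¹) * r := by gcongr
        _ = r * (ε ^ 2 * (1 + (K ^ 8)⁻¹)) := by ring
    -- sum of the coefficients ≤ M
    have hcoef : ρ + ρ + ε * (1 + (K ^ 8)⁻¹) + ε ^ 2 * (1 + (K ^ 8)⁻¹) ≤ M := by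
      have h1 : ρ ≤ ε ^ 4 * Real.exp (-10 * K ^ 10) := hρε
      have h2 : ε ^ 4 * Real.exp (-10 * K ^ 10) ≤ ε ^ 4 := by
        have : Real.exp (-10 * K ^ 10) ≤ 1 := by
          rw [Real.exp_le_one_iff]; have := pow_nonneg hK.le 10; linarith
        exact mul_le_of_le_one_right (by positivity) this
      have h3 : ε ^ 4 ≤ ε ^ 2 := pow_le_pow_of_le_one hε.le hε1 (by norm_num)
      have h4 : ε ^ 2 ≤ ε * (K ^ 100)⁻¹ := by rw [pow_two]; gcongr
      have h5 : (K ^ 100)⁻¹ ≤ 1 / 10 ^ 6 * (K ^ 8)⁻¹ :=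
        (hs.inv_pow_anti (by norm_num : 9 ≤ 100)).trans (hs.inv_pow_succ_le 8)
      have h6 : (K ^ 8)⁻¹ ≤ 1 / 2 := hs.inv_K_pow_le_half (by norm_num)
      have hw : ε ^ 2 ≤ 1 / 10 ^ 6 * (ε * (K ^ 8)⁻¹) := by
        calc ε ^ 2 ≤ ε * (K ^ 100)⁻¹ := h4
          _ ≤ ε * (1 / 10 ^ 6 * (K ^ 8)⁻¹) := by gcongr
          _ = _ := by ring
      have hQ : ε ^ 2 * (K ^ 8)⁻¹ ≤ ε ^ 2 * (1 / 2) := mul_le_mul_of_nonneg_left h6 (sq_nonneg ε)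
      have hP : 0 ≤ ε * (K ^ 8)⁻¹ := by positivity
      simp only [hM]
      nlinarith
    nlinarith
  have hmain := sqrt_sq_add_sq_le_of_deriv (hs.continuousOn_Y 1 0 (b := T) hs.τ₀_le)
    (hs.continuousOn_Y 2 0 (b := T) hs.τ₀_le)
    (fun x hx => hs.hasDerivWithinAt_Y 1 0 (hs.τ₀_le.trans hx.1))
    (fun x hx => hs.hasDerivWithinAt_Y 2 0 (hs.τ₀_le.trans hx.1)) hM0 le_rfl hbound ht
  rw [zero_mul, Real.exp_zero, one_mul, sub_zero] at hmain
  -- the initial value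
  have hinit : Real.sqrt (Y 1 0 0 ^ 2 + Y 2 0 0 ^ 2) ≤ (1 / 10 ^ 5 + (K ^ 8)⁻¹) * ε := by
    have hb := hs.hyp.b_abs_le
    have hc := hs.hyp.c_abs_le
    have hc' : |Y 2 0 0| ≤ (K ^ 8)⁻¹ * ε := by
      have hγ1 : 1 / 10 ^ 5 * Real.exp (-K ^ 10 / 2) ≤ 1 := by
        have : Real.exp (-K ^ 10 / 2) ≤ 1 := by
          rw [Real.exp_le_one_iff]; have := pow_nonneg hK.le 10; linarith
        linarith [Real.exp_pos (-K ^ 10 / 2)]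
      have h8 : (K ^ 100)⁻¹ ≤ (K ^ 8)⁻¹ := hs.inv_pow_anti (by norm_num)
      calc |Y 2 0 0| ≤ 1 / 10 ^ 5 * Real.exp (-K ^ 10 / 2) * ε ^ 2 := hc
        _ ≤ 1 * ε ^ 2 := by gcongr
        _ = ε * ε := by ring
        _ ≤ (K ^ 100)⁻¹ * ε := by gcongr
        _ ≤ (K ^ 8)⁻¹ * ε := by gcongr
    rw [Real.sqrt_le_iff]
    refine ⟨by positivity, ?_⟩
    have hb0 := abs_nonneg (Y 1 0 0)
    have hc0 := abs_nonneg (Y 2 0 0)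
    calc Y 1 0 0 ^ 2 + Y 2 0 0 ^ 2 = |Y 1 0 0| ^ 2 + |Y 2 0 0| ^ 2 := by rw [sq_abs, sq_abs]
      _ ≤ (|Y 1 0 0| + |Y 2 0 0|) ^ 2 := by nlinarith
      _ ≤ ((1 / 10 ^ 5 + (K ^ 8)⁻¹) * ε) ^ 2 := by
          apply pow_le_pow_left₀ (by positivity)
          calc |Y 1 0 0| + |Y 2 0 0| ≤ 1 / 10 ^ 5 * ε + (K ^ 8)⁻¹ * ε := add_le_add hb hc'
            _ = _ := by ring
  have ht0 : 0 ≤ t := ht.1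
  have ht100 : t ≤ 100 := ht.2.trans hs.T_le
  have hK87 : (K ^ 8)⁻¹ ≤ 1 / 10 ^ 6 * (K ^ 7)⁻¹ := hs.inv_pow_succ_le 7
  have hK7 : 0 < (K ^ 7)⁻¹ := by positivity
  calc Real.sqrt (Y 1 0 t ^ 2 + Y 2 0 t ^ 2)
      ≤ Real.sqrt (Y 1 0 0 ^ 2 + Y 2 0 0 ^ 2) + M * t := hmain
    _ ≤ (1 / 10 ^ 5 + (K ^ 8)⁻¹) * ε + M * t := by gcongr
    _ = (1 / 10 ^ 5 + t + (K ^ 8)⁻¹ * (1 + 2 * t)) * ε := by simp only [hM]; ring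
    _ ≤ (1 / 10 ^ 5 + t + (K ^ 7)⁻¹) * ε := by
        gcongr
        nlinarith

/-- **(6.147)** for `b₀`: `|b₀(t)| ≤ (10⁻⁵ + t + K⁻⁷) ε` on `[0, T]`.
[cite: Tao2016AveragedNS, §6.7 (6.147)] -/
theorem Setting.abs_b_zero_le (hs : Setting ε₀ K ε C₁ C₂ C₃ C₄ C₅ n₀ N τ Y F T) {t : ℝ}
    (ht : t ∈ Icc 0 T) : |Y 1 0 t| ≤ (1 / 10 ^ 5 + t + (K ^ 7)⁻¹) * ε :=
  (Real.abs_le_sqrt (by nlinarith [sq_nonneg (Y 2 0 t)])).trans (hs.sqrt_bc_le ht)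

/-- **(6.147)** for `c₀`: `|c₀(t)| ≤ (10⁻⁵ + t + K⁻⁷) ε` on `[0, T]`.
[cite: Tao2016AveragedNS, §6.7 (6.147)] -/
theorem Setting.abs_c_zero_le' (hs : Setting ε₀ K ε C₁ C₂ C₃ C₄ C₅ n₀ N τ Y F T) {t : ℝ}
    (ht : t ∈ Icc 0 T) : |Y 2 0 t| ≤ (1 / 10 ^ 5 + t + (K ^ 7)⁻¹) * ε :=
  (Real.abs_le_sqrt (by nlinarith [sq_nonneg (Y 1 0 t)])).trans (hs.sqrt_bc_le ht)

/-- **(6.148)** (with the corrected initial bound (6.56)): on `[0, T]`,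
`|c₀(t)| ≤ 10⁻⁴ ε² exp(K¹⁰ t (10⁻⁵ + t + K⁻⁷) - K¹⁰/2)` (printed:
`≲ ε² exp(K¹⁰(-1/4 + 10⁻⁵ t + t²/2 + O(K⁻¹)))`; by Grönwall from (6.131), (6.147)).
[cite: Tao2016AveragedNS, §6.7 (6.148)] -/
theorem Setting.abs_c_zero_le (hs : Setting ε₀ K ε C₁ C₂ C₃ C₄ C₅ n₀ N τ Y F T) {t : ℝ}
    (ht : t ∈ Icc 0 T) :
    |Y 2 0 t| ≤ 1 / 10 ^ 4 * ε ^ 2 *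
      Real.exp (K ^ 10 * (t * (1 / 10 ^ 5 + t + (K ^ 7)⁻¹)) - K ^ 10 / 2) := by
  have hK := hs.K_pos
  have hε := hs.ε_pos
  have hε1 := hs.ε_le_one hε
  have hεK := hs.ε_le_K100
  have hρ := hs.ρ_le
  have hτ₀ := hs.τ₀_le
  set ρ := C₁ * (1 + ε₀) ^ (-(n₀ : ℝ) / 2) with hρdef
  have hρ0 : 0 ≤ ρ := mul_nonneg hs.C₁_nn (Real.rpow_nonneg hs.q_pos.le _)
  set β : ℝ → ℝ := fun s => ε⁻¹ * K ^ 10 * Y 1 0 s with hβ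
  set R : ℝ → ℝ := fun s => ε ^ 2 * Real.exp (-K ^ 10) * Y 0 0 s ^ 2 + ρ with hR
  have hgc : ContinuousOn (Y 2 0) (Icc 0 T) := hs.continuousOn_Y 2 0 hτ₀
  have hβc : ContinuousOn β (Icc 0 T) := (hs.continuousOn_Y 1 0 hτ₀).const_smul (ε⁻¹ * K ^ 10)
  have hRc : ContinuousOn R (Icc 0 T) :=
    (((hs.continuousOn_Y 0 0 hτ₀).pow 2).const_smul (ε ^ 2 * Real.exp (-K ^ 10))).add
      continuousOn_const
  have hR0 : ∀ s ∈ Icc 0 T, 0 ≤ R s := fun s _ => by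
    simp only [hR]; exact add_nonneg (by positivity) hρ0
  have hbound : ∀ s ∈ Ico 0 T, |dY (τ (n₀ - N)) Y 2 0 s - β s * Y 2 0 s| ≤ R s := by
    intro s hs'
    have h := hs.dc_zero (Ico_subset_Icc_self hs')
    simp only [hβ, hR]
    have key : dY (τ (n₀ - N)) Y 2 0 s - ε⁻¹ * K ^ 10 * Y 1 0 s * Y 2 0 s =
        (dY (τ (n₀ - N)) Y 2 0 s -
          (ε ^ 2 * Real.exp (-K ^ 10) * Y 0 0 s ^ 2 + ε⁻¹ * K ^ 10 * Y 1 0 s * Y 2 0 s)) +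
        ε ^ 2 * Real.exp (-K ^ 10) * Y 0 0 s ^ 2 := by ring
    rw [key]
    refine (abs_add_le _ _).trans ?_
    rw [abs_of_nonneg (by positivity : (0:ℝ) ≤ ε ^ 2 * Real.exp (-K ^ 10) * Y 0 0 s ^ 2)]
    linarith
  have hmain := ODE.abs_le_linearComparison hgc
    (fun s hs' => hs.hasDerivWithinAt_Y 2 0 (hτ₀.trans hs'.1)) hRc hR0 hβc hbound ht
  -- the integral of |β|
  set L := K ^ 10 * (1 / 10 ^ 5 + t + (K ^ 7)⁻¹) with hL
  have hL0 : 0 ≤ L := by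
    have : 0 ≤ t := ht.1
    have : 0 < (K ^ 7)⁻¹ := by positivity
    simp only [hL]; positivity
  have hI1 : ∫ s in (0:ℝ)..t, |β s| ≤ L * t := by
    have hle : ∀ s ∈ Icc 0 t, |β s| ≤ L := by
      intro s hs'
      have hsT : s ∈ Icc 0 T := ⟨hs'.1, hs'.2.trans ht.2⟩
      have hb := hs.abs_b_zero_le hsT
      simp only [hβ, hL]
      rw [abs_mul, abs_of_pos (by positivity : (0:ℝ) < ε⁻¹ * K ^ 10)]
      calc ε⁻¹ * K ^ 10 * |Y 1 0 s| ≤ ε⁻¹ * K ^ 10 * ((1 / 10 ^ 5 + s + (K ^ 7)⁻¹) * ε) := by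
            gcongr
        _ = K ^ 10 * (1 / 10 ^ 5 + s + (K ^ 7)⁻¹) := by field_simp
        _ ≤ K ^ 10 * (1 / 10 ^ 5 + t + (K ^ 7)⁻¹) := by gcongr; exact hs'.2
    have hβi : IntervalIntegrable (fun s => |β s|) volume 0 t :=
      ((hβc.mono (Icc_subset_Icc le_rfl ht.2)).abs).intervalIntegrable_of_Icc ht.1
    calc ∫ s in (0:ℝ)..t, |β s| ≤ ∫ s in (0:ℝ)..t, L :=
          intervalIntegral.integral_mono_on ht.1 hβi intervalIntegrable_const hle
      _ = L * t := by simp [mul_comm]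
  -- the integral of R
  have hI2 : ∫ s in (0:ℝ)..t, R s ≤ (2 * ε ^ 2 * Real.exp (-K ^ 10) + ρ) * t := by
    have hle : ∀ s ∈ Icc 0 t, R s ≤ 2 * ε ^ 2 * Real.exp (-K ^ 10) + ρ := by
      intro s hs'
      have hsT : s ∈ Icc 0 T := ⟨hs'.1, hs'.2.trans ht.2⟩
      have ha := hs.sq_Y_zero_le 0 hsT
      simp only [hR]
      nlinarith [Real.exp_pos (-K ^ 10), sq_nonneg ε, mul_pos (pow_pos hε 2) (Real.exp_pos (-K ^ 10))]
    have hRi : IntervalIntegrable R volume 0 t :=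
      (hRc.mono (Icc_subset_Icc le_rfl ht.2)).intervalIntegrable_of_Icc ht.1
    calc ∫ s in (0:ℝ)..t, R s ≤ ∫ s in (0:ℝ)..t, (2 * ε ^ 2 * Real.exp (-K ^ 10) + ρ) :=
          intervalIntegral.integral_mono_on ht.1 hRi intervalIntegrable_const hle
      _ = (2 * ε ^ 2 * Real.exp (-K ^ 10) + ρ) * t := by simp; ring
  -- the initial value
  have h0 : |Y 2 0 0| ≤ 1 / 10 ^ 5 * Real.exp (-K ^ 10 / 2) * ε ^ 2 := hs.hyp.c_abs_le
  -- assemble: |c₀(t)| ≤ exp(L t) (γ ε² + (2ε²e^{-K¹⁰} + ρ) t)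
  have ht100 : t ≤ 100 := ht.2.trans hs.T_le
  have hexpL : Real.exp (∫ s in (0:ℝ)..t, |β s|) ≤ Real.exp (L * t) := Real.exp_le_exp.2 hI1
  have hsum : |Y 2 0 0| + ∫ s in (0:ℝ)..t, R s ≤
      1 / 10 ^ 4 * ε ^ 2 * Real.exp (-K ^ 10 / 2) := by
    -- `(2ε²e^{-K¹⁰} + ρ) t ≤ 9·10⁻⁵ ε² e^{-K¹⁰/2}`
    have hhalf : Real.exp (-K ^ 10) = Real.exp (-K ^ 10 / 2) * Real.exp (-K ^ 10 / 2) := by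
      rw [← Real.exp_add]; congr 1; ring
    have he := hs.exp_half_le
    have he0 := Real.exp_pos (-K ^ 10 / 2)
    have hK100 : (K ^ 100)⁻¹ ≤ 1 / 10 ^ 12 := by
      have h1 := hs.inv_pow_succ_le 99
      have h2 := hs.inv_pow_succ_le 98
      have h98 : (K ^ 98)⁻¹ ≤ 1 := by
        have := hs.inv_pow_anti (n := 0) (m := 98) (by norm_num); simpa using this
      nlinarith
    set E := Real.exp (-K ^ 10 / 2) with hE
    have hρ' : ρ ≤ ε ^ 2 * E * (K ^ 100)⁻¹ := by
      calc ρ ≤ ε ^ 4 * Real.exp (-10 * K ^ 10) := hρ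
        _ = ε ^ 2 * E * (ε ^ 2 * Real.exp (-(19 : ℝ) / 2 * K ^ 10)) := by
            rw [show ε ^ 4 = ε ^ 2 * ε ^ 2 by ring,
              show (-10 * K ^ 10 : ℝ) = -K ^ 10 / 2 + -(19 : ℝ) / 2 * K ^ 10 by ring, Real.exp_add]
            ring
        _ ≤ ε ^ 2 * E * ((K ^ 100)⁻¹ * 1) := by
            gcongr
            · calc ε ^ 2 ≤ ε := by nlinarith
                _ ≤ _ := hεK
            · rw [Real.exp_le_one_iff]; have := pow_nonneg hK.le 10; nlinarith
        _ = _ := by ring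
    rw [hhalf] at hI2
    have hε2E : 0 < ε ^ 2 * E := mul_pos (pow_pos hε 2) he0
    have hbr0 : 0 ≤ 2 * ε ^ 2 * (E * E) + ρ := by positivity
    have hI2' : ∫ s in (0:ℝ)..t, R s ≤ (2 * ε ^ 2 * (E * E) + ρ) * 100 :=
      hI2.trans (mul_le_mul_of_nonneg_left ht100 hbr0)
    have hEE : ε ^ 2 * (E * E) ≤ ε ^ 2 * E * (1 / 10 ^ 12) := by
      rw [← mul_assoc]; exact mul_le_mul_of_nonneg_left (he.trans hK100) hε2E.le
    have hρ'' : ρ ≤ ε ^ 2 * E * (1 / 10 ^ 12) := hρ'.trans (mul_le_mul_of_nonneg_left hK100 hε2E.le)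
    have h0' : |Y 2 0 0| ≤ 1 / 10 ^ 5 * (ε ^ 2 * E) := by rw [hE]; linarith
    linarith
  calc |Y 2 0 t| ≤ Real.exp (∫ s in (0:ℝ)..t, |β s|) * (|Y 2 0 0| + ∫ s in (0:ℝ)..t, R s) := hmain
    _ ≤ Real.exp (L * t) * (1 / 10 ^ 4 * ε ^ 2 * Real.exp (-K ^ 10 / 2)) := by
        apply mul_le_mul hexpL hsum ?_ (Real.exp_pos _).le
        have : 0 ≤ ∫ s in (0:ℝ)..t, R s :=
          intervalIntegral.integral_nonneg ht.1 fun s hs' => hR0 s ⟨hs'.1, hs'.2.trans ht.2⟩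
        positivity
    _ = 1 / 10 ^ 4 * ε ^ 2 * Real.exp (K ^ 10 * (t * (1 / 10 ^ 5 + t + (K ^ 7)⁻¹)) - K ^ 10 / 2) := by
        rw [sub_eq_add_neg, Real.exp_add]
        simp only [hL]
        ring_nf

/-! ## The critical time `t_c` of §6.7 -/

/-- The predicate "`|c₀(t)| ≤ K⁻¹⁰ ε²`" defining the time `t_c` of §6.7.
[cite: Tao2016AveragedNS, §6.7 (the time t_c)] -/
def SmallC (K ε : ℝ) (Y : Fin 4 → ℤ → ℝ → ℝ) (t : ℝ) : Prop :=
  |Y 2 0 t| ≤ (K ^ 10)⁻¹ * ε ^ 2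

/-- **The time `t_c`** of §6.7: the supremum of the times `t ∈ [0, T]` with `|c₀| ≤ K⁻¹⁰ ε²` on
`[0, t]` (`maximalTimeP`). [cite: Tao2016AveragedNS, §6.7 (the time t_c)] -/
def tc (K ε : ℝ) (Y : Fin 4 → ℤ → ℝ → ℝ) (T : ℝ) : ℝ :=
  ODE.maximalTimeP (SmallC K ε Y) 0 T

/-- `|c₀(0)| ≤ K⁻¹⁰ ε²`. [cite: Tao2016AveragedNS, §6.7 (the time t_c)] -/
theorem Setting.smallC_zero (hs : Setting ε₀ K ε C₁ C₂ C₃ C₄ C₅ n₀ N τ Y F T) : SmallC K ε Y 0 := by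
  unfold SmallC
  have hc := hs.hyp.c_abs_le
  have hK := hs.K_pos
  have he : Real.exp (-K ^ 10 / 2) ≤ (K ^ 100)⁻¹ := hs.exp_half_le
  have h100 : (K ^ 100)⁻¹ ≤ (K ^ 10)⁻¹ := hs.inv_pow_anti (by norm_num)
  have hek : Real.exp (-K ^ 10 / 2) ≤ (K ^ 10)⁻¹ := he.trans h100
  calc |Y 2 0 0| ≤ 1 / 10 ^ 5 * Real.exp (-K ^ 10 / 2) * ε ^ 2 := hc
    _ ≤ 1 * (K ^ 10)⁻¹ * ε ^ 2 := by gcongr; norm_num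
    _ = _ := by ring

/-- `t_c ∈ [0, T]`. [cite: Tao2016AveragedNS, §6.7 (the time t_c)] -/
theorem Setting.tc_mem (hs : Setting ε₀ K ε C₁ C₂ C₃ C₄ C₅ n₀ N τ Y F T) :
    tc K ε Y T ∈ Icc 0 T :=
  ODE.maximalTimeP_mem hs.T_nn hs.smallC_zero

/-- `|c₀(t)| ≤ K⁻¹⁰ ε²` on `[0, t_c]`. [cite: Tao2016AveragedNS, §6.7 (the time t_c)] -/
theorem Setting.smallC_of_mem_tc (hs : Setting ε₀ K ε C₁ C₂ C₃ C₄ C₅ n₀ N τ Y F T) {t : ℝ}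
    (ht : t ∈ Icc 0 (tc K ε Y T)) : SmallC K ε Y t := by
  refine ODE.maximalTimeP_spec hs.T_nn hs.smallC_zero (fun s hs' hP => ?_) ht
  exact le_of_Ico_of_continuousOn (F := fun u => |Y 2 0 u|) hs'.1
    ((hs.continuousOn_Y 2 0 hs.τ₀_le).abs) hP

/-- For `t ≤ 1/2` in `[0, T]`, (6.148) gives `|c₀(t)| ≤ K⁻¹⁰ ε²`.
[cite: Tao2016AveragedNS, §6.7 (the time t_c)] -/
theorem Setting.smallC_of_le_half (hs : Setting ε₀ K ε C₁ C₂ C₃ C₄ C₅ n₀ N τ Y F T) {t : ℝ}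
    (ht : t ∈ Icc 0 T) (ht2 : t ≤ 1 / 2) : SmallC K ε Y t := by
  unfold SmallC
  have h := hs.abs_c_zero_le ht
  have hK := hs.K_pos
  have hK7 : (K ^ 7)⁻¹ ≤ 1 / 2 := hs.inv_K_pow_le_half (by norm_num)
  have hK70 : 0 < (K ^ 7)⁻¹ := by positivity
  have hexp : Real.exp (K ^ 10 * (t * (1 / 10 ^ 5 + t + (K ^ 7)⁻¹)) - K ^ 10 / 2) ≤ (K ^ 10)⁻¹ := by
    have h1 : K ^ 10 * (t * (1 / 10 ^ 5 + t + (K ^ 7)⁻¹)) - K ^ 10 / 2 ≤ -(10 * K) := by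
      have ht0 := ht.1
      have h2 : t * (1 / 10 ^ 5 + t + (K ^ 7)⁻¹) ≤ 1 / 2 * (1 / 10 ^ 5 + 1 / 2 + 1 / 10 ^ 5) := by
        have : (K ^ 7)⁻¹ ≤ 1 / 10 ^ 5 := by
          have := hs.inv_pow_succ_le 6
          have h6 : (K ^ 6)⁻¹ ≤ 1 := by
            have := hs.inv_pow_anti (n := 0) (m := 6) (by norm_num); simpa using this
          linarith
        apply mul_le_mul ht2 (by linarith) (by positivity) (by norm_num)
      have hK6 := hs.K_large
      have hK2 : K ^ 2 ≤ K ^ 10 := pow_le_pow_right₀ hs.one_le_K (by norm_num)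
      nlinarith
    calc Real.exp (K ^ 10 * (t * (1 / 10 ^ 5 + t + (K ^ 7)⁻¹)) - K ^ 10 / 2)
        ≤ Real.exp (-(10 * K)) := Real.exp_le_exp.2 h1
      _ ≤ (K ^ 10)⁻¹ := by
          rw [Real.exp_neg]
          apply inv_anti₀ (pow_pos hK 10)
          have := pow_le_exp_mul hK.le 10
          simpa using this
  have hε2 : 0 ≤ ε ^ 2 := sq_nonneg ε
  calc |Y 2 0 t| ≤ 1 / 10 ^ 4 * ε ^ 2 *
        Real.exp (K ^ 10 * (t * (1 / 10 ^ 5 + t + (K ^ 7)⁻¹)) - K ^ 10 / 2) := h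
    _ ≤ 1 * ε ^ 2 * (K ^ 10)⁻¹ := by gcongr; norm_num
    _ = _ := by ring

/-- `t_c ≥ min(T, 1/2)` (the source's "`t_c ≥ 1/2`"). [cite: Tao2016AveragedNS, §6.7 (the time t_c)] -/
theorem Setting.min_le_tc (hs : Setting ε₀ K ε C₁ C₂ C₃ C₄ C₅ n₀ N τ Y F T) :
    min T (1 / 2) ≤ tc K ε Y T :=
  ODE.le_maximalTimeP ⟨le_min hs.T_nn (by norm_num), min_le_left _ _⟩ fun t ht =>
    hs.smallC_of_le_half ⟨ht.1, ht.2.trans (min_le_left _ _)⟩ (ht.2.trans (min_le_right _ _))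

/-- `exp 1 ≤ 3`. [folklore] -/
theorem exp_one_le_three : Real.exp 1 ≤ 3 := by
  have := Real.exp_one_lt_d9; norm_num at this; linarith

/-- **(t_c)**: while `|c₀| ≤ K⁻¹⁰ ε²` (on `[0, t⋆]`, `t⋆ ≤ T`), the modes `d₀, a₁` stay small:
`√(d₀² + a₁²) ≤ 700 K⁻¹⁰` (from (6.132)–(6.133): the `K d₀ a₁` terms cancel in `d₀∂d₀ + a₁∂a₁`).
[cite: Tao2016AveragedNS, §6.7 (6.149)–(6.150)] -/
theorem Setting.sqrt_da_le (hs : Setting ε₀ K ε C₁ C₂ C₃ C₄ C₅ n₀ N τ Y F T) {T' : ℝ}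
    (hT' : T' ∈ Icc 0 T) (hP : ∀ s ∈ Icc 0 T', SmallC K ε Y s) {t : ℝ} (ht : t ∈ Icc 0 T') :
    Real.sqrt (Y 3 0 t ^ 2 + Y 0 1 t ^ 2) ≤ 700 * (K ^ 10)⁻¹ := by
  have hK := hs.K_pos
  have hε := hs.ε_pos
  have hε1 := hs.ε_le_one hε
  have hεK := hs.ε_le_K100
  have hρ := hs.ρ_le_ε
  have hτ₀ := hs.τ₀_le
  have hK10 : 0 < (K ^ 10)⁻¹ := by positivity
  set ρ := C₁ * (1 + ε₀) ^ (-(n₀ : ℝ) / 2) with hρdef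
  have hρ0 : 0 ≤ ρ := mul_nonneg hs.C₁_nn (Real.rpow_nonneg hs.q_pos.le _)
  set M : ℝ := 2 * (K ^ 10)⁻¹ with hM
  set L : ℝ := 16 * C₄ * ε ^ 2 with hL
  have hL0 : 0 ≤ L := by have := hs.C₄_nn; positivity
  -- smallness of the constant terms
  have hE : ρ + 4 * C₄ * Real.exp (-K ^ 10 / 2) * (K ^ 10)⁻¹ + 4 * ρ ≤ 1 / 2 * (K ^ 10)⁻¹ := by
    have h1 : ρ ≤ (K ^ 100)⁻¹ := hρ.trans hεK
    have h2 : (K ^ 100)⁻¹ ≤ 1 / 10 ^ 6 * (K ^ 10)⁻¹ :=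
      (hs.inv_pow_anti (by norm_num : 11 ≤ 100)).trans (hs.inv_pow_succ_le 10)
    have h3 : C₄ * Real.exp (-K ^ 10 / 2) ≤ 1 / 10 ^ 6 := by
      calc C₄ * Real.exp (-K ^ 10 / 2) ≤ K * (K ^ 100)⁻¹ :=
            mul_le_mul hs.C₄_le hs.exp_half_le (Real.exp_pos _).le hK.le
        _ ≤ (K ^ 99)⁻¹ := hs.mul_inv_pow_succ_le le_rfl 99
        _ ≤ 1 / 10 ^ 6 * (K ^ 98)⁻¹ := hs.inv_pow_succ_le 98
        _ ≤ 1 / 10 ^ 6 * 1 := by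
            gcongr; have := hs.inv_pow_anti (n := 0) (m := 98) (by norm_num); simpa using this
        _ = _ := mul_one _
    nlinarith
  have hbound : ∀ x ∈ Ico 0 T',
      Y 3 0 x * dY (τ (n₀ - N)) Y 3 0 x + Y 0 1 x * dY (τ (n₀ - N)) Y 0 1 x ≤
        M * Real.sqrt (Y 3 0 x ^ 2 + Y 0 1 x ^ 2) + L * (Y 3 0 x ^ 2 + Y 0 1 x ^ 2) := by
    intro x hx
    have hxT : x ∈ Icc 0 T := ⟨hx.1, hx.2.le.trans hT'.2⟩
    have hrd := hs.dd_zero hxT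
    have hr1' := hs.da_one hxT
    have hc := hP x (Ico_subset_Icc_self hx)
    unfold SmallC at hc
    have ha := hs.abs_Y_zero_le 0 hxT
    set a := Y 0 0 x; set c := Y 2 0 x; set d := Y 3 0 x; set a₁ := Y 0 1 x
    set Dd := dY (τ (n₀ - N)) Y 3 0 x; set D1 := dY (τ (n₀ - N)) Y 0 1 x
    set q52 := (1 + ε₀) ^ ((5 : ℝ) / 2)
    set rd := Dd - ((ε ^ 2)⁻¹ * c * a - q52 * K * d * a₁)
    set r1 := D1 - q52 * K * d ^ 2
    set B := 4 * C₄ * Real.exp (-K ^ 10 / 2) * (K ^ 10)⁻¹ + 4 * ρ with hB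
    have hr1 : |r1| ≤ 16 * C₄ * ε ^ 2 * |a₁| + B := by
      simp only [hB, hρdef]; linarith [hr1']
    have key : d * Dd + a₁ * D1 = (ε ^ 2)⁻¹ * c * a * d + d * rd + a₁ * r1 := by
      simp only [rd, r1]; ring
    rw [key]
    set r := Real.sqrt (d ^ 2 + a₁ ^ 2)
    have hdr : |d| ≤ r := Real.abs_le_sqrt (by nlinarith)
    have ha1r : |a₁| ≤ r := Real.abs_le_sqrt (by nlinarith)
    have hr0 : 0 ≤ r := Real.sqrt_nonneg _
    have hr2 : r ^ 2 = d ^ 2 + a₁ ^ 2 := Real.sq_sqrt (by positivity)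
    -- first term
    have e1 : (ε ^ 2)⁻¹ * c * a * d ≤ r * (3 / 2 * (K ^ 10)⁻¹) := by
      calc (ε ^ 2)⁻¹ * c * a * d ≤ |(ε ^ 2)⁻¹ * c * a * d| := le_abs_self _
        _ = (ε ^ 2)⁻¹ * |c| * |a| * |d| := by
            rw [abs_mul, abs_mul, abs_mul, abs_of_pos (by positivity : (0:ℝ) < (ε ^ 2)⁻¹)]
        _ ≤ (ε ^ 2)⁻¹ * ((K ^ 10)⁻¹ * ε ^ 2) * (3 / 2) * r := by gcongr
        _ = r * (3 / 2 * (K ^ 10)⁻¹) := by field_simp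
    have e2 : d * rd ≤ r * ρ := by
      calc d * rd ≤ |d * rd| := le_abs_self _
        _ = |d| * |rd| := abs_mul _ _
        _ ≤ r * ρ := mul_le_mul hdr hrd (abs_nonneg _) hr0
    have e3 : a₁ * r1 ≤ r * (16 * C₄ * ε ^ 2 * r + B) := by
      calc a₁ * r1 ≤ |a₁ * r1| := le_abs_self _
        _ = |a₁| * |r1| := abs_mul _ _
        _ ≤ r * (16 * C₄ * ε ^ 2 * |a₁| + B) := mul_le_mul ha1r hr1 (abs_nonneg _) hr0
        _ ≤ _ := by have := hs.C₄_nn; gcongr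
    have hcoef : 3 / 2 * (K ^ 10)⁻¹ + ρ + B ≤ M := by simp only [hM, hB]; linarith
    calc (ε ^ 2)⁻¹ * c * a * d + d * rd + a₁ * r1
        ≤ r * (3 / 2 * (K ^ 10)⁻¹) + r * ρ + r * (16 * C₄ * ε ^ 2 * r + B) :=
          add_le_add (add_le_add e1 e2) e3
      _ = (3 / 2 * (K ^ 10)⁻¹ + ρ + B) * r + L * r ^ 2 := by simp only [hL]; ring
      _ ≤ M * r + L * r ^ 2 := by gcongr
      _ = M * r + L * (d ^ 2 + a₁ ^ 2) := by rw [hr2]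
  have hmain := sqrt_sq_add_sq_le_of_deriv (hs.continuousOn_Y 3 0 (b := T') hτ₀)
    (hs.continuousOn_Y 0 1 (b := T') hτ₀)
    (fun x hx => hs.hasDerivWithinAt_Y 3 0 (hτ₀.trans hx.1))
    (fun x hx => hs.hasDerivWithinAt_Y 0 1 (hτ₀.trans hx.1)) (by positivity) hL0 hbound ht
  rw [sub_zero] at hmain
  -- initial value
  have hinit : Real.sqrt (Y 3 0 0 ^ 2 + Y 0 1 0 ^ 2) ≤ 2 * (K ^ 10)⁻¹ := by
    have hd := hs.hyp.d_abs_le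
    have ha1 : |Y 0 1 0| ≤ (K ^ 10)⁻¹ := by
      have h1 := hs.sq_Y_le 0 1 hτ₀
      have h2 := hs.F_one_zero_le
      have h3 : (K ^ 30)⁻¹ ≤ 1 / 10 ^ 6 * (K ^ 20)⁻¹ :=
        (hs.inv_pow_anti (by norm_num : 21 ≤ 30)).trans (hs.inv_pow_succ_le 20)
      have h4 : (K ^ 10)⁻¹ ^ 2 = (K ^ 20)⁻¹ := by rw [← inv_pow, ← pow_mul, inv_pow]
      have h5 : (0:ℝ) ≤ (K ^ 20)⁻¹ := by positivity
      have hsq : Y 0 1 0 ^ 2 ≤ ((K ^ 10)⁻¹) ^ 2 := by rw [h4]; linarith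
      calc |Y 0 1 0| = Real.sqrt (Y 0 1 0 ^ 2) := (Real.sqrt_sq_eq_abs _).symm
        _ ≤ Real.sqrt (((K ^ 10)⁻¹) ^ 2) := Real.sqrt_le_sqrt hsq
        _ = (K ^ 10)⁻¹ := Real.sqrt_sq hK10.le
    rw [Real.sqrt_le_iff]
    refine ⟨by positivity, ?_⟩
    calc Y 3 0 0 ^ 2 + Y 0 1 0 ^ 2 = |Y 3 0 0| ^ 2 + |Y 0 1 0| ^ 2 := by rw [sq_abs, sq_abs]
      _ ≤ (|Y 3 0 0| + |Y 0 1 0|) ^ 2 := by nlinarith [abs_nonneg (Y 3 0 0), abs_nonneg (Y 0 1 0)]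
      _ ≤ (2 * (K ^ 10)⁻¹) ^ 2 := by
          apply pow_le_pow_left₀ (by positivity); linarith
  -- the exponential factor
  have ht100 : t ≤ 100 := ht.2.trans (hT'.2.trans hs.T_le)
  have hexp : Real.exp (L * t) ≤ 3 := by
    have hLt : L * t ≤ 1 := by
      have hC₄ := hs.C₄_le
      have hC₄0 := hs.C₄_nn
      have : L ≤ 16 * K * (K ^ 100)⁻¹ * ε := by
        simp only [hL]; rw [pow_two]
        calc 16 * C₄ * (ε * ε) ≤ 16 * K * ((K ^ 100)⁻¹ * ε) := by gcongr
          _ = _ := by ring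
      have h2 : K * (K ^ 100)⁻¹ ≤ (K ^ 99)⁻¹ := hs.mul_inv_pow_succ_le le_rfl 99
      have h3 : (K ^ 99)⁻¹ ≤ 1 / 10 ^ 6 * (K ^ 98)⁻¹ := hs.inv_pow_succ_le 98
      have h4 : (K ^ 98)⁻¹ ≤ 1 := by
        have := hs.inv_pow_anti (n := 0) (m := 98) (by norm_num); simpa using this
      have ht0 := ht.1
      nlinarith
    calc Real.exp (L * t) ≤ Real.exp 1 := Real.exp_le_exp.2 hLt
      _ ≤ 3 := exp_one_le_three
  have ht0 := ht.1
  have hM0 : 0 ≤ M := by positivity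
  calc Real.sqrt (Y 3 0 t ^ 2 + Y 0 1 t ^ 2)
      ≤ Real.exp (L * t) * (Real.sqrt (Y 3 0 0 ^ 2 + Y 0 1 0 ^ 2) + M * t) := hmain
    _ ≤ 3 * (2 * (K ^ 10)⁻¹ + M * 100) := by gcongr
    _ ≤ 700 * (K ^ 10)⁻¹ := by simp only [hM]; nlinarith

/-! ## The interval `[0, t_c]`: `a₀ ≈ 1`, `b₀` affine, `Ẽ₋₁` frozen, `c₀` ignites -/

/-- While `|c₀| ≤ K⁻¹⁰ ε²` (on `[0, T']`): `a₀² ≥ 1 - 2K⁻⁸` (from (6.146), (6.147) and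
`Setting.sqrt_da_le`). [cite: Tao2016AveragedNS, §6.7 (the display `a₀(t) = 1 + O(K⁻⁹)`)] -/
theorem Setting.sq_a_zero_ge (hs : Setting ε₀ K ε C₁ C₂ C₃ C₄ C₅ n₀ N τ Y F T) {T' : ℝ}
    (hT' : T' ∈ Icc 0 T) (hP : ∀ s ∈ Icc 0 T', SmallC K ε Y s) {t : ℝ} (ht : t ∈ Icc 0 T') :
    1 - 2 * (K ^ 8)⁻¹ ≤ Y 0 0 t ^ 2 := by
  have htT : t ∈ Icc 0 T := ⟨ht.1, ht.2.trans hT'.2⟩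
  have hS := hs.sumSq_bound htT
  have hbc := hs.sqrt_bc_le htT
  have hda := hs.sqrt_da_le hT' hP ht
  have hK := hs.K_pos
  have hε := hs.ε_pos
  have hεK := hs.ε_le_K100
  have hK8 : 0 < (K ^ 8)⁻¹ := by positivity
  have ht100 : t ≤ 100 := htT.2.trans hs.T_le
  -- squares of the two pairs
  have h1 : Y 1 0 t ^ 2 + Y 2 0 t ^ 2 ≤ ((1 / 10 ^ 5 + t + (K ^ 7)⁻¹) * ε) ^ 2 := by
    have h0 : 0 ≤ Y 1 0 t ^ 2 + Y 2 0 t ^ 2 := by positivity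
    have := pow_le_pow_left₀ (Real.sqrt_nonneg _) hbc 2
    rwa [Real.sq_sqrt h0] at this
  have h2 : Y 3 0 t ^ 2 + Y 0 1 t ^ 2 ≤ (700 * (K ^ 10)⁻¹) ^ 2 := by
    have h0 : 0 ≤ Y 3 0 t ^ 2 + Y 0 1 t ^ 2 := by positivity
    have := pow_le_pow_left₀ (Real.sqrt_nonneg _) hda 2
    rwa [Real.sq_sqrt h0] at this
  -- both are ≤ ½ K⁻⁸
  have hK7 : (K ^ 7)⁻¹ ≤ 1 := by
    have := hs.inv_pow_anti (n := 0) (m := 7) (by norm_num); simpa using this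
  have h1' : ((1 / 10 ^ 5 + t + (K ^ 7)⁻¹) * ε) ^ 2 ≤ 1 / 2 * (K ^ 8)⁻¹ := by
    have hc : (1 / 10 ^ 5 + t + (K ^ 7)⁻¹) * ε ≤ 102 * ε := by
      have : 1 / 10 ^ 5 + t + (K ^ 7)⁻¹ ≤ 102 := by linarith
      exact mul_le_mul_of_nonneg_right this hε.le
    have hc0 : 0 ≤ (1 / 10 ^ 5 + t + (K ^ 7)⁻¹) * ε := by
      have := ht.1; positivity
    have h102 : (102 * ε) ^ 2 ≤ 1 / 2 * (K ^ 8)⁻¹ := by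
      have hε1 := hs.ε_le_one hε
      have h100_8 : (K ^ 100)⁻¹ ≤ 1 / 10 ^ 6 * (K ^ 8)⁻¹ :=
        (hs.inv_pow_anti (by norm_num : 9 ≤ 100)).trans (hs.inv_pow_succ_le 8)
      nlinarith
    exact (pow_le_pow_left₀ hc0 hc 2).trans h102
  have h2' : (700 * (K ^ 10)⁻¹) ^ 2 ≤ 1 / 2 * (K ^ 8)⁻¹ := by
    have h10 : (K ^ 10)⁻¹ ≤ 1 / 10 ^ 6 * (K ^ 9)⁻¹ := hs.inv_pow_succ_le 9
    have h9 : (K ^ 9)⁻¹ ≤ 1 / 10 ^ 6 * (K ^ 8)⁻¹ := hs.inv_pow_succ_le 8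
    have h9' : (K ^ 9)⁻¹ ≤ 1 := by
      have := hs.inv_pow_anti (n := 0) (m := 9) (by norm_num); simpa using this
    have hK10 : 0 ≤ (K ^ 10)⁻¹ := by positivity
    nlinarith
  rw [abs_le] at hS
  unfold sumSq at hS
  nlinarith

/-- While `|c₀| ≤ K⁻¹⁰ ε²` (on `[0, T']`): `1 - 2K⁻⁸ ≤ a₀(t) ≤ 1 + K⁻⁸` (the display
`a₀(t) = 1 + O(K⁻⁹)` of §6.7; positivity of `a₀` by continuity from `a₀(0) = 1`).
[cite: Tao2016AveragedNS, §6.7 (the display `a₀(t) = 1 + O(K⁻⁹)`)] -/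
theorem Setting.a_zero_bounds (hs : Setting ε₀ K ε C₁ C₂ C₃ C₄ C₅ n₀ N τ Y F T) {T' : ℝ}
    (hT' : T' ∈ Icc 0 T) (hP : ∀ s ∈ Icc 0 T', SmallC K ε Y s) {t : ℝ} (ht : t ∈ Icc 0 T') :
    1 - 2 * (K ^ 8)⁻¹ ≤ Y 0 0 t ∧ Y 0 0 t ≤ 1 + (K ^ 8)⁻¹ := by
  have hK := hs.K_pos
  have hK8 : 0 < (K ^ 8)⁻¹ := by positivity
  have hK8' : (K ^ 8)⁻¹ ≤ 1 / 2 := hs.inv_K_pow_le_half (by norm_num)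
  have hsq := hs.sq_a_zero_ge hT' hP ht
  -- positivity of `a₀` on `[0, t]`
  have hpos : 0 < Y 0 0 t := by
    by_contra hle
    push Not at hle
    have hcont : ContinuousOn (Y 0 0) (Icc 0 t) := hs.continuousOn_Y 0 0 hs.τ₀_le
    have h0 : Y 0 0 0 = 1 := hs.hyp.a_eq
    obtain ⟨s, hsI, hs0⟩ := intermediate_value_Icc' ht.1 hcont ⟨hle, by rw [h0]; norm_num⟩
    have hsq' := hs.sq_a_zero_ge hT' hP ⟨hsI.1, hsI.2.trans ht.2⟩
    rw [hs0] at hsq'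
    norm_num at hsq'
    have : (K ^ 8)⁻¹ ≤ 1 / 10 ^ 6 * (K ^ 7)⁻¹ := hs.inv_pow_succ_le 7
    have h7 : (K ^ 7)⁻¹ ≤ 1 := by
      have := hs.inv_pow_anti (n := 0) (m := 7) (by norm_num); simpa using this
    linarith
  constructor
  · -- `a₀ ≥ √(1 - 2K⁻⁸) ≥ 1 - 2K⁻⁸`
    have hy0 : 0 ≤ 1 - 2 * (K ^ 8)⁻¹ := by linarith
    have hy1 : 1 - 2 * (K ^ 8)⁻¹ ≤ 1 := by linarith
    calc 1 - 2 * (K ^ 8)⁻¹ ≤ Real.sqrt (1 - 2 * (K ^ 8)⁻¹) := by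
          rw [Real.le_sqrt hy0 hy0]; nlinarith
      _ ≤ Real.sqrt (Y 0 0 t ^ 2) := Real.sqrt_le_sqrt hsq
      _ = Y 0 0 t := by rw [Real.sqrt_sq hpos.le]
  · have hup := hs.sq_a_zero_le ⟨ht.1, ht.2.trans hT'.2⟩
    nlinarith

/-- While `|c₀| ≤ K⁻¹⁰ ε²` (on `[0, T']`): the lower affine bound (6.157)
`b₀(t) ≥ -10⁻⁵ ε + ε (1 - 5K⁻⁸) t` (from (6.130) and `a₀² ≥ 1 - 4K⁻⁸`).
[cite: Tao2016AveragedNS, §6.7 (6.157)] -/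
theorem Setting.b_zero_ge (hs : Setting ε₀ K ε C₁ C₂ C₃ C₄ C₅ n₀ N τ Y F T) {T' : ℝ}
    (hT' : T' ∈ Icc 0 T) (hP : ∀ s ∈ Icc 0 T', SmallC K ε Y s) {t : ℝ} (ht : t ∈ Icc 0 T') :
    -(1 / 10 ^ 5 * ε) + ε * (1 - 5 * (K ^ 8)⁻¹) * t ≤ Y 1 0 t := by
  have hK := hs.K_pos
  have hε := hs.ε_pos
  have hτ₀ := hs.τ₀_le
  have hbound : ∀ x ∈ Ico 0 T', ε * (1 - 5 * (K ^ 8)⁻¹) ≤ dY (τ (n₀ - N)) Y 1 0 x := by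
    intro x hx
    have hxT' : x ∈ Icc 0 T' := Ico_subset_Icc_self hx
    have hxT : x ∈ Icc 0 T := ⟨hx.1, hx.2.le.trans hT'.2⟩
    have hrb := hs.db_zero hxT
    have ha := hs.sq_a_zero_ge hT' hP hxT'
    have hc := hP x hxT'
    unfold SmallC at hc
    have hρ := hs.ρ_le_ε
    have hεK := hs.ε_le_K100
    have hK10 : 0 < (K ^ 10)⁻¹ := by positivity
    have hK8 : 0 < (K ^ 8)⁻¹ := by positivity
    -- `ε⁻¹ K¹⁰ c₀² ≤ K⁻¹⁰ ε³ ≤ ε K⁻⁸ · 10⁻⁶`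
    have hc2 : ε⁻¹ * K ^ 10 * Y 2 0 x ^ 2 ≤ (K ^ 10)⁻¹ * ε ^ 3 := by
      have h1 : Y 2 0 x ^ 2 ≤ ((K ^ 10)⁻¹ * ε ^ 2) ^ 2 := by
        have := pow_le_pow_left₀ (abs_nonneg _) hc 2; rwa [sq_abs] at this
      calc ε⁻¹ * K ^ 10 * Y 2 0 x ^ 2 ≤ ε⁻¹ * K ^ 10 * ((K ^ 10)⁻¹ * ε ^ 2) ^ 2 := by gcongr
        _ = (K ^ 10)⁻¹ * ε ^ 3 := by field_simp
    have hsmall : (K ^ 10)⁻¹ * ε ^ 3 + C₁ * (1 + ε₀) ^ (-(n₀ : ℝ) / 2) ≤ ε * (K ^ 8)⁻¹ := by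
      have hε1 := hs.ε_le_one hε
      have h100_8 : (K ^ 100)⁻¹ ≤ 1 / 10 ^ 6 * (K ^ 8)⁻¹ :=
        (hs.inv_pow_anti (by norm_num : 9 ≤ 100)).trans (hs.inv_pow_succ_le 8)
      have h10_8 : (K ^ 10)⁻¹ ≤ (K ^ 8)⁻¹ := hs.inv_pow_anti (by norm_num)
      have hρ4 := hs.ρ_le
      have e0 : ε ^ 4 * Real.exp (-10 * K ^ 10) ≤ ε * ε := by
        have he : Real.exp (-10 * K ^ 10) ≤ 1 := by
          rw [Real.exp_le_one_iff]; have := pow_nonneg hK.le 10; linarith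
        calc ε ^ 4 * Real.exp (-10 * K ^ 10) ≤ ε ^ 4 * 1 := by gcongr
          _ = ε * ε * (ε * ε) := by ring
          _ ≤ ε * ε * (1 * 1) := by gcongr
          _ = ε * ε := by ring
      have e1 : (K ^ 10)⁻¹ * ε ^ 3 ≤ ε * (K ^ 8)⁻¹ * (1 / 4) := by
        have hε2 : ε ^ 2 ≤ 1 / 4 := by
          have h8 : (K ^ 8)⁻¹ ≤ 1 := by
            have := hs.inv_pow_anti (n := 0) (m := 8) (by norm_num); simpa using this
          have : ε ≤ 1 / 2 := by linarith
          nlinarith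
        calc (K ^ 10)⁻¹ * ε ^ 3 = ε * (K ^ 10)⁻¹ * ε ^ 2 := by ring
          _ ≤ ε * (K ^ 8)⁻¹ * (1 / 4) := by gcongr
      have e2 : C₁ * (1 + ε₀) ^ (-(n₀ : ℝ) / 2) ≤ ε * (K ^ 8)⁻¹ * (1 / 10 ^ 6) := by
        calc C₁ * (1 + ε₀) ^ (-(n₀ : ℝ) / 2) ≤ ε * ε := hρ4.trans e0
          _ ≤ ε * (K ^ 100)⁻¹ := by gcongr
          _ ≤ ε * (1 / 10 ^ 6 * (K ^ 8)⁻¹) := by gcongr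
          _ = ε * (K ^ 8)⁻¹ * (1 / 10 ^ 6) := by ring
      have hP0 : 0 ≤ ε * (K ^ 8)⁻¹ := by positivity
      linarith
    rw [abs_le] at hrb
    nlinarith
  have h := add_mul_le_of_le_deriv (hs.continuousOn_Y 1 0 (b := T') hτ₀)
    (fun x hx => hs.hasDerivWithinAt_Y 1 0 (hτ₀.trans hx.1)) hbound ht
  have hb0 := hs.hyp.b_abs_le
  rw [abs_le] at hb0
  rw [sub_zero] at h
  linarith [hb0.1]

/-- While `|c₀| ≤ K⁻¹⁰ ε²` (on `[0, T']`): `Ẽ₋₁` barely moves,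
`Ẽ₋₁(t) ≤ K⁻²⁰ + 8K⁻¹⁴ t` (from (6.49) at `k = -1`, `a₀ ≥ 0`, and (6.92) at `m = 2, 3`; the
source's "`∂ₜẼ₋₁ ≤ O(K⁻¹⁴)` … which rules out the first option of Corollary 6.14").
[cite: Tao2016AveragedNS, §6.7 (before (6.154))] -/
theorem Setting.F_negOne_le_tc (hs : Setting ε₀ K ε C₁ C₂ C₃ C₄ C₅ n₀ N τ Y F T) {T' : ℝ}
    (hT' : T' ∈ Icc 0 T) (hP : ∀ s ∈ Icc 0 T', SmallC K ε Y s) {t : ℝ} (ht : t ∈ Icc 0 T') :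
    F (-1) t ≤ (K ^ 20)⁻¹ + 8 * (K ^ 14)⁻¹ * t := by
  have hK := hs.K_pos
  have hτ₀ := hs.τ₀_le
  have hbound : ∀ x ∈ Ico 0 T', dF (τ (n₀ - N)) F (-1) x ≤ 8 * (K ^ 14)⁻¹ := by
    intro x hx
    have hxT' : x ∈ Icc 0 T' := Ico_subset_Icc_self hx
    have hxT : x ∈ Icc 0 T := ⟨hx.1, hx.2.le.trans hT'.2⟩
    have h := hs.dF_negOne (hτ₀.trans hx.1)
    have ha0 := (hs.a_zero_bounds hT' hP hxT').1
    have hK8 : (K ^ 8)⁻¹ ≤ 1 / 2 := hs.inv_K_pow_le_half (by norm_num)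
    have ha0' : 0 ≤ Y 0 0 x := by linarith
    have hd2 := hs.sq_Y_negTwo_le 3 hxT
    have ha1 := hs.abs_Y_negOne_le 0 hxT
    have hq := hs.qm52_le
    have hq0 : 0 ≤ (1 + ε₀) ^ (-(5 : ℝ) / 2) := Real.rpow_nonneg hs.q_pos.le _
    have hq5 : 0 ≤ (1 + ε₀) ^ ((5 : ℝ) / 2) := Real.rpow_nonneg hs.q_pos.le _
    have hneg : (1 + ε₀) ^ ((5 : ℝ) / 2) * Y 3 (-1) x ^ 2 * Y 0 0 x ≥ 0 := by positivity
    have hpos : Y 3 (-2) x ^ 2 * Y 0 (-1) x ≤ 4 * (K ^ 10)⁻¹ * (2 * (K ^ 5)⁻¹) := by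
      calc Y 3 (-2) x ^ 2 * Y 0 (-1) x ≤ Y 3 (-2) x ^ 2 * |Y 0 (-1) x| := by
            gcongr; exact le_abs_self _
        _ ≤ 4 * (K ^ 10)⁻¹ * (2 * (K ^ 5)⁻¹) := by gcongr
    have hK15 : K * ((1 + ε₀) ^ (-(5 : ℝ) / 2)) * (4 * (K ^ 10)⁻¹ * (2 * (K ^ 5)⁻¹)) ≤
        8 * (K ^ 14)⁻¹ := by
      calc K * ((1 + ε₀) ^ (-(5 : ℝ) / 2)) * (4 * (K ^ 10)⁻¹ * (2 * (K ^ 5)⁻¹))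
          ≤ K * 1 * (4 * (K ^ 10)⁻¹ * (2 * (K ^ 5)⁻¹)) := by gcongr
        _ = 8 * (K ^ 14)⁻¹ := by field_simp; ring
    calc dF (τ (n₀ - N)) F (-1) x
        ≤ K * (1 + ε₀) ^ (-(5 : ℝ) / 2) *
          (Y 3 (-2) x ^ 2 * Y 0 (-1) x - (1 + ε₀) ^ ((5 : ℝ) / 2) * Y 3 (-1) x ^ 2 * Y 0 0 x) := h
      _ ≤ K * (1 + ε₀) ^ (-(5 : ℝ) / 2) * (Y 3 (-2) x ^ 2 * Y 0 (-1) x) := by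
          apply mul_le_mul_of_nonneg_left _ (by positivity); linarith
      _ ≤ K * (1 + ε₀) ^ (-(5 : ℝ) / 2) * (4 * (K ^ 10)⁻¹ * (2 * (K ^ 5)⁻¹)) := by
          apply mul_le_mul_of_nonneg_left hpos (by positivity)
      _ ≤ 8 * (K ^ 14)⁻¹ := hK15
  have h := le_add_mul_of_deriv_le (hs.continuousOn_F (-1) (b := T') hτ₀)
    (fun x hx => hs.hasDerivWithinAt_F (-1) (hτ₀.trans hx.1)) hbound ht
  have h0 := hs.hyp.energy_prev_le
  rw [sub_zero] at h
  linarith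

/-- While `|c₀| ≤ K⁻¹⁰ ε²` (on `[0, T']`, `T' ≤ T`): `Ẽ₋₁ < K⁻¹⁰ (1+ε₀)^{2/10}` on `[0, T']`, i.e.
the "backwards flow of energy" exit of Cor. 6.14 does not occur before `t_c`.
[cite: Tao2016AveragedNS, §6.7 (before (6.154))] -/
theorem Setting.F_negOne_lt_exit (hs : Setting ε₀ K ε C₁ C₂ C₃ C₄ C₅ n₀ N τ Y F T) {T' : ℝ}
    (hT' : T' ∈ Icc 0 T) (hP : ∀ s ∈ Icc 0 T', SmallC K ε Y s) {t : ℝ} (ht : t ∈ Icc 0 T') :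
    F (-1) t < (K ^ 10)⁻¹ * (1 + ε₀) ^ ((2 : ℝ) / 10) := by
  have h := hs.F_negOne_le_tc hT' hP ht
  have hK := hs.K_pos
  have ht100 : t ≤ 100 := (ht.2.trans hT'.2).trans hs.T_le
  have h20 : (K ^ 20)⁻¹ ≤ 1 / 10 ^ 6 * (K ^ 10)⁻¹ :=
    (hs.inv_pow_anti (by norm_num : 11 ≤ 20)).trans (hs.inv_pow_succ_le 10)
  have h14 : (K ^ 14)⁻¹ ≤ 1 / 10 ^ 6 * (K ^ 10)⁻¹ :=
    (hs.inv_pow_anti (by norm_num : 11 ≤ 14)).trans (hs.inv_pow_succ_le 10)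
  have hK10 : 0 < (K ^ 10)⁻¹ := by positivity
  have hq : 1 ≤ (1 + ε₀) ^ ((2 : ℝ) / 10) := hs.one_le_q_rpow (by norm_num)
  have hK14 : 0 ≤ (K ^ 14)⁻¹ := by positivity
  calc F (-1) t ≤ (K ^ 20)⁻¹ + 8 * (K ^ 14)⁻¹ * t := h
    _ ≤ (K ^ 20)⁻¹ + 8 * (K ^ 14)⁻¹ * 100 := by gcongr
    _ < (K ^ 10)⁻¹ * 1 := by nlinarith
    _ ≤ (K ^ 10)⁻¹ * (1 + ε₀) ^ ((2 : ℝ) / 10) := by gcongr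

/-- **`c₀` ignites** (the display "`c₀(t) ≳ exp((t²/2 - 10⁻⁵t - 1 + O(K⁻⁹))K¹⁰) ε²`" of
§6.7, here for `10⁻⁵ ≤ t ≤ T'` while `|c₀| ≤ K⁻¹⁰ε²` on `[0, T']`): by the landed
`c_lower_of_affine_rate` applied to (6.131) with the affine bounds (6.147)/(6.157) on `b₀` and
`c₀(0) ≥ -(1+ε₀)^{-n₀/4}`. [cite: Tao2016AveragedNS, §6.7 (display before (6.158))] -/
theorem Setting.c_zero_lower (hs : Setting ε₀ K ε C₁ C₂ C₃ C₄ C₅ n₀ N τ Y F T) {T' : ℝ}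
    (hT' : T' ∈ Icc 0 T) (hP : ∀ s ∈ Icc 0 T', SmallC K ε Y s) {t : ℝ} (ht : t ∈ Icc 0 T')
    (ht5 : 1 / 10 ^ 5 ≤ t) :
    4 / 10 ^ 6 * ε ^ 2 *
        Real.exp (K ^ 10 * (t ^ 2 / 2 - (1 / 10 ^ 5 + (K ^ 7)⁻¹) * t) - 1001 / 1000 * K ^ 10) ≤
      Y 2 0 t := by
  have hK := hs.K_pos
  have hε := hs.ε_pos
  have hε1 := hs.ε_le_one hε
  have hεK := hs.ε_le_K100
  have hτ₀ := hs.τ₀_le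
  have hK7 : 0 < (K ^ 7)⁻¹ := by positivity
  have hK8 : 0 < (K ^ 8)⁻¹ := by positivity
  have hK7' : (K ^ 7)⁻¹ ≤ 1 := by
    have := hs.inv_pow_anti (n := 0) (m := 7) (by norm_num); simpa using this
  have hK8q : (K ^ 8)⁻¹ ≤ 1 / 10 ^ 6 := by
    have := hs.inv_pow_succ_le 7; linarith
  have hK100 : (K ^ 100)⁻¹ ≤ 1 / 10 ^ 6 := by
    have h := hs.inv_pow_succ_le 99
    have h99 : (K ^ 99)⁻¹ ≤ 1 := by
      have := hs.inv_pow_anti (n := 0) (m := 99) (by norm_num); simpa using this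
    linarith
  have hε6 : ε ≤ 1 / 10 ^ 6 := hεK.trans hK100
  have hε2 : ε ^ 2 ≤ 1 / 10 ^ 7 := by nlinarith
  have hρ : C₁ * (1 + ε₀) ^ (-(n₀ : ℝ) / 2) ≤ ε ^ 4 * Real.exp (-10 * K ^ 10) := hs.ρ_le
  have hρ0 : 0 ≤ C₁ * (1 + ε₀) ^ (-(n₀ : ℝ) / 2) :=
    mul_nonneg hs.C₁_nn (Real.rpow_nonneg hs.q_pos.le _)
  set ρ := C₁ * (1 + ε₀) ^ (-(n₀ : ℝ) / 2) with hρdef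
  set μ : ℝ := ε⁻¹ * K ^ 10 with hμ
  set p : ℝ := (1 / 10 ^ 5 + (K ^ 7)⁻¹) * ε with hp
  set lam₀ : ℝ := ε ^ 2 * Real.exp (-K ^ 10) * (1 - 2 * (K ^ 8)⁻¹) with hlam
  have he0 := Real.exp_pos (-K ^ 10)
  have hE := mul_pos (pow_pos hε 2) he0
  have hlam0 : 0 ≤ lam₀ := by simp only [hlam]; apply mul_nonneg hE.le; linarith
  have hlam_ge : ε ^ 2 * Real.exp (-K ^ 10) * (1 / 2) ≤ lam₀ := by
    simp only [hlam]; apply mul_le_mul_of_nonneg_left _ hE.le; linarith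
  -- `ρ ≤ ε² e^{-K¹⁰}/20`
  have hρsmall : ρ ≤ ε ^ 2 * Real.exp (-K ^ 10) * (1 / 20) := by
    have he : Real.exp (-10 * K ^ 10) ≤ Real.exp (-K ^ 10) := by
      apply Real.exp_le_exp.2; have := pow_nonneg hK.le 10; linarith
    calc ρ ≤ ε ^ 4 * Real.exp (-10 * K ^ 10) := hρ
      _ = ε ^ 2 * Real.exp (-10 * K ^ 10) * ε ^ 2 := by ring
      _ ≤ ε ^ 2 * Real.exp (-K ^ 10) * (1 / 20) := by gcongr; linarith
  -- hypotheses of `c_lower_of_affine_rate`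
  have hbound : ∀ x ∈ Ico 0 T', lam₀ + μ * Y 1 0 x * Y 2 0 x - ρ ≤ dY (τ (n₀ - N)) Y 2 0 x := by
    intro x hx
    have hxT' : x ∈ Icc 0 T' := Ico_subset_Icc_self hx
    have hxT : x ∈ Icc 0 T := ⟨hx.1, hx.2.le.trans hT'.2⟩
    have h := hs.dc_zero hxT
    have ha := hs.sq_a_zero_ge hT' hP hxT'
    rw [abs_le] at h
    have : lam₀ ≤ ε ^ 2 * Real.exp (-K ^ 10) * Y 0 0 x ^ 2 := by
      simp only [hlam]; exact mul_le_mul_of_nonneg_left ha hE.le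
    have e : μ * Y 1 0 x * Y 2 0 x = ε⁻¹ * K ^ 10 * Y 1 0 x * Y 2 0 x := by simp only [hμ]
    rw [e]
    linarith [h.1]
  have hblo : ∀ x ∈ Icc 0 T', ε * (x - 0) - p ≤ Y 1 0 x := by
    intro x hx
    have h := hs.b_zero_ge hT' hP hx
    have hx100 : x ≤ 100 := (hx.2.trans hT'.2).trans hs.T_le
    have h87 : (K ^ 8)⁻¹ ≤ 1 / 10 ^ 6 * (K ^ 7)⁻¹ := hs.inv_pow_succ_le 7
    have hx0 := hx.1
    have h5 : 5 * (K ^ 8)⁻¹ * x ≤ (K ^ 7)⁻¹ := by nlinarith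
    have h5' := mul_le_mul_of_nonneg_left h5 hε.le
    simp only [hp]
    nlinarith
  have hbhi : ∀ x ∈ Icc 0 T', Y 1 0 x ≤ ε * (x - 0) + p := by
    intro x hx
    have h := hs.abs_b_zero_le ⟨hx.1, hx.2.trans hT'.2⟩
    rw [abs_le] at h
    simp only [hp]; linarith [h.2]
  have hca : -((1 + ε₀) ^ (-(n₀ : ℝ) / 4)) ≤ Y 2 0 0 := hs.hyp.c_ge
  have hle : ρ ≤ lam₀ := by linarith
  have hw0 : (0 : ℝ) < 1 / 10 ^ 5 := by norm_num
  have hwt : (1 : ℝ) / 10 ^ 5 ≤ t - 0 := by linarith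
  -- the small exponent at the window `w = 10⁻⁵`
  have hexpw : Real.exp (-(1 / 1000 * K ^ 10)) ≤
      Real.exp (-(μ * (ε * (1 / 10 ^ 5) ^ 2 / 2 + p * (1 / 10 ^ 5)))) := by
    apply Real.exp_le_exp.2
    have e : μ * (ε * (1 / 10 ^ 5) ^ 2 / 2 + p * (1 / 10 ^ 5)) =
        K ^ 10 * ((1 / 10 ^ 5) ^ 2 / 2 + (1 / 10 ^ 5 + (K ^ 7)⁻¹) * (1 / 10 ^ 5)) := by
      simp only [hμ, hp]; field_simp
    rw [e]
    have := pow_nonneg hK.le 10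
    nlinarith
  -- the ignition quantity
  have hη : (1 + ε₀) ^ (-(n₀ : ℝ) / 4) ≤ 1 / 10 ^ 7 * ε ^ 2 * Real.exp (-(1001 / 1000 * K ^ 10)) := by
    have h4 : (1 + ε₀) ^ (-(n₀ : ℝ) / 4) ≤ ε ^ 4 * Real.exp (-10 * K ^ 10) :=
      hs.q_n₀_quarter_le hs.ε₀_pos hs.C₁_nn hs.C₂_nn hs.C₅_nn
    have he : Real.exp (-10 * K ^ 10) ≤ Real.exp (-(1001 / 1000 * K ^ 10)) := by
      apply Real.exp_le_exp.2; have := pow_nonneg hK.le 10; nlinarith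
    calc (1 + ε₀) ^ (-(n₀ : ℝ) / 4) ≤ ε ^ 4 * Real.exp (-10 * K ^ 10) := h4
      _ = ε ^ 2 * ε ^ 2 * Real.exp (-10 * K ^ 10) := by ring
      _ ≤ 1 / 10 ^ 7 * ε ^ 2 * Real.exp (-(1001 / 1000 * K ^ 10)) := by gcongr
  have hsplit : Real.exp (-K ^ 10) * Real.exp (-(1 / 1000 * K ^ 10)) =
      Real.exp (-(1001 / 1000 * K ^ 10)) := by rw [← Real.exp_add]; congr 1; ring
  have hE0 := Real.exp_pos (-(1001 / 1000 * K ^ 10))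
  have hE1 := Real.exp_pos (-(1 / 1000 * K ^ 10))
  have hX' : 4 / 10 ^ 6 * ε ^ 2 * Real.exp (-(1001 / 1000 * K ^ 10)) ≤
      (lam₀ - ρ) * (1 / 10 ^ 5) * Real.exp (-(μ * (ε * (1 / 10 ^ 5) ^ 2 / 2 + p * (1 / 10 ^ 5)))) -
        (1 + ε₀) ^ (-(n₀ : ℝ) / 4) := by
    have hlr : ε ^ 2 * Real.exp (-K ^ 10) * (9 / 20) ≤ lam₀ - ρ := by linarith
    have hlr0 : 0 ≤ ε ^ 2 * Real.exp (-K ^ 10) * (9 / 20) := by positivity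
    have key : ε ^ 2 * Real.exp (-K ^ 10) * (9 / 20) * (1 / 10 ^ 5) *
        Real.exp (-(1 / 1000 * K ^ 10)) ≤
        (lam₀ - ρ) * (1 / 10 ^ 5) * Real.exp (-(μ * (ε * (1 / 10 ^ 5) ^ 2 / 2 + p * (1 / 10 ^ 5)))) :=
      mul_le_mul (mul_le_mul_of_nonneg_right hlr hw0.le) hexpw hE1.le
        (mul_nonneg (hlr0.trans hlr) hw0.le)
    have e : ε ^ 2 * Real.exp (-K ^ 10) * (9 / 20) * (1 / 10 ^ 5) *
        Real.exp (-(1 / 1000 * K ^ 10)) =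
        9 / 20 * (1 / 10 ^ 5) * (ε ^ 2 * Real.exp (-(1001 / 1000 * K ^ 10))) := by
      rw [← hsplit]; ring
    rw [e] at key
    have hF := mul_pos (pow_pos hε 2) hE0
    linarith
  have hX : 0 ≤ (lam₀ - ρ) * (1 / 10 ^ 5) *
      Real.exp (-(μ * (ε * (1 / 10 ^ 5) ^ 2 / 2 + p * (1 / 10 ^ 5)))) - (1 + ε₀) ^ (-(n₀ : ℝ) / 4) :=
    le_trans (by positivity) hX'
  have hmain := c_lower_of_affine_rate (σ := ε) (hs.continuousOn_Y 2 0 (b := T') hτ₀)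
    (fun x hx => hs.hasDerivWithinAt_Y 2 0 (hτ₀.trans hx.1)) (hs.continuousOn_Y 1 0 hτ₀)
    (by positivity : (0:ℝ) ≤ μ) hbound hblo hbhi hε.le (by positivity) hca hle ht hw0 hwt hX
  -- the growth exponent
  have hexp : μ * (ε * (t - 0) ^ 2 / 2 - p * (t - 0)) =
      K ^ 10 * (t ^ 2 / 2 - (1 / 10 ^ 5 + (K ^ 7)⁻¹) * t) := by
    simp only [hμ, hp, sub_zero]; field_simp
  rw [hexp] at hmain
  have hG := Real.exp_pos (K ^ 10 * (t ^ 2 / 2 - (1 / 10 ^ 5 + (K ^ 7)⁻¹) * t))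
  calc 4 / 10 ^ 6 * ε ^ 2 *
        Real.exp (K ^ 10 * (t ^ 2 / 2 - (1 / 10 ^ 5 + (K ^ 7)⁻¹) * t) - 1001 / 1000 * K ^ 10)
      = Real.exp (K ^ 10 * (t ^ 2 / 2 - (1 / 10 ^ 5 + (K ^ 7)⁻¹) * t)) *
          (4 / 10 ^ 6 * ε ^ 2 * Real.exp (-(1001 / 1000 * K ^ 10))) := by
        rw [sub_eq_add_neg, Real.exp_add]; ring
    _ ≤ Real.exp (K ^ 10 * (t ^ 2 / 2 - (1 / 10 ^ 5 + (K ^ 7)⁻¹) * t)) *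
          ((lam₀ - ρ) * (1 / 10 ^ 5) *
              Real.exp (-(μ * (ε * (1 / 10 ^ 5) ^ 2 / 2 + p * (1 / 10 ^ 5)))) -
            (1 + ε₀) ^ (-(n₀ : ℝ) / 4)) :=
        mul_le_mul_of_nonneg_left hX' hG.le
    _ ≤ Y 2 0 t := hmain

/-- **`t_c < 2`** (the source's (6.158) "`t_c ≤ 2` (say)"): at `t = 2` the ignition bound would
exceed `K⁻¹⁰ ε²`. [cite: Tao2016AveragedNS, §6.7 (6.158)] -/
theorem Setting.tc_lt_two (hs : Setting ε₀ K ε C₁ C₂ C₃ C₄ C₅ n₀ N τ Y F T) : tc K ε Y T < 2 := by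
  by_contra h2
  push Not at h2
  have htc := hs.tc_mem
  have hP : ∀ s ∈ Icc 0 (tc K ε Y T), SmallC K ε Y s := fun s hs' => hs.smallC_of_mem_tc hs'
  have h := hs.c_zero_lower htc hP (t := 2) ⟨by norm_num, h2⟩ (by norm_num)
  have hc := hP 2 ⟨by norm_num, h2⟩
  unfold SmallC at hc
  rw [abs_le] at hc
  have hK := hs.K_pos
  have hε := hs.ε_pos
  have hK7 : (K ^ 7)⁻¹ ≤ 1 / 10 ^ 5 := by
    have := hs.inv_pow_succ_le 6
    have h6 : (K ^ 6)⁻¹ ≤ 1 := by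
      have := hs.inv_pow_anti (n := 0) (m := 6) (by norm_num); simpa using this
    linarith
  -- the exponent at `t = 2` is ≥ (99/100) K¹⁰ ≥ 0, so the bound is ≥ 4·10⁻⁶ ε² e^{0} > K⁻¹⁰ ε²
  have hexp : 1 ≤ Real.exp (K ^ 10 * ((2 : ℝ) ^ 2 / 2 - (1 / 10 ^ 5 + (K ^ 7)⁻¹) * 2) -
      1001 / 1000 * K ^ 10) := by
    apply Real.one_le_exp
    have := pow_nonneg hK.le 10
    nlinarith
  have hK10 : (K ^ 10)⁻¹ < 4 / 10 ^ 6 := by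
    have h := hs.inv_pow_succ_le 9
    have h9 : (K ^ 9)⁻¹ ≤ 1 := by
      have := hs.inv_pow_anti (n := 0) (m := 9) (by norm_num); simpa using this
    linarith
  nlinarith [mul_pos (pow_pos hε 2) (by norm_num : (0:ℝ) < 4 / 10 ^ 6), hc.2,
    mul_le_mul_of_nonneg_left hexp (by positivity : (0:ℝ) ≤ 4 / 10 ^ 6 * ε ^ 2)]

/-- `∫₀ᵗ a₁² ≤ 4.9·10⁵ K⁻²⁰ t` while `|c₀| ≤ K⁻¹⁰ ε²` on `[0, T']` (so the "forwards flow of energy"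
exit `∫ a₁² = K^{-1/4}` of Cor. 6.14 does not occur before `t_c`).
[cite: Tao2016AveragedNS, §6.7 (before (6.154))] -/
theorem Setting.integral_a_one_sq_le (hs : Setting ε₀ K ε C₁ C₂ C₃ C₄ C₅ n₀ N τ Y F T) {T' : ℝ}
    (hT' : T' ∈ Icc 0 T) (hP : ∀ s ∈ Icc 0 T', SmallC K ε Y s) {t : ℝ} (ht : t ∈ Icc 0 T') :
    ∫ s in (0:ℝ)..t, Y 0 1 s ^ 2 ≤ (700 * (K ^ 10)⁻¹) ^ 2 * t := by
  have hτ₀ := hs.τ₀_le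
  have hle : ∀ s ∈ Icc 0 t, Y 0 1 s ^ 2 ≤ (700 * (K ^ 10)⁻¹) ^ 2 := by
    intro s hs'
    have hda := hs.sqrt_da_le hT' hP ⟨hs'.1, hs'.2.trans ht.2⟩
    have h0 : 0 ≤ Y 3 0 s ^ 2 + Y 0 1 s ^ 2 := by positivity
    have := pow_le_pow_left₀ (Real.sqrt_nonneg _) hda 2
    rw [Real.sq_sqrt h0] at this
    nlinarith [sq_nonneg (Y 3 0 s)]
  have hcont : ContinuousOn (fun s => Y 0 1 s ^ 2) (Icc 0 t) := (hs.continuousOn_Y 0 1 hτ₀).pow 2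
  calc ∫ s in (0:ℝ)..t, Y 0 1 s ^ 2 ≤ ∫ s in (0:ℝ)..t, (700 * (K ^ 10)⁻¹) ^ 2 :=
        intervalIntegral.integral_mono_on ht.1 (hcont.intervalIntegrable_of_Icc ht.1)
          intervalIntegrable_const hle
    _ = (700 * (K ^ 10)⁻¹) ^ 2 * t := by simp [mul_comm]

/-- **`t_c < T`**: `t_c` is an exit by equality, not by running out of the interval `[0, T]` —
each alternative of Cor. 6.14 at `T = t_c` is excluded (backwards flow by `F_negOne_lt_exit`,
forwards flow by `integral_a_one_sq_le`, `T = 100` by `t_c < 2`).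
[cite: Tao2016AveragedNS, §6.7 (6.158)–(6.159)] -/
theorem Setting.tc_lt_T (hs : Setting ε₀ K ε C₁ C₂ C₃ C₄ C₅ n₀ N τ Y F T)
    (hex : ExitTrichotomy ε₀ K Y F T) : tc K ε Y T < T := by
  have htc := hs.tc_mem
  rcases lt_or_eq_of_le htc.2 with hlt | heq
  · exact hlt
  exfalso
  have hP : ∀ s ∈ Icc 0 T, SmallC K ε Y s := fun s hs' =>
    hs.smallC_of_mem_tc (by rw [heq]; exact hs')
  have hT : T ∈ Icc 0 T := ⟨hs.T_nn, le_rfl⟩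
  rcases hex with h1 | h2 | h3
  · exact absurd h1 (ne_of_lt (hs.F_negOne_lt_exit hT hP hT))
  · have hint := hs.integral_a_one_sq_le hT hP hT
    have hK := hs.K_pos
    have hT100 := hs.T_le
    have hK10 : 0 < (K ^ 10)⁻¹ := by positivity
    have h10 : (K ^ 10)⁻¹ ≤ 1 / 10 ^ 6 * (K ^ 9)⁻¹ := hs.inv_pow_succ_le 9
    have h9 : (K ^ 9)⁻¹ ≤ 1 / 10 ^ 6 * (K ^ 8)⁻¹ := hs.inv_pow_succ_le 8
    have h8 : (K ^ 8)⁻¹ ≤ (K ^ 1)⁻¹ := hs.inv_pow_anti (by norm_num)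
    have hq : (K ^ 1)⁻¹ ≤ K ^ (-(1 : ℝ) / 4) := by
      rw [pow_one, ← Real.rpow_neg_one]
      exact Real.rpow_le_rpow_of_exponent_le hs.one_le_K (by norm_num)
    rw [h2] at hint
    have hq0 : 0 < K ^ (-(1 : ℝ) / 4) := Real.rpow_pos_of_pos hK _
    have h10' : (K ^ 10)⁻¹ ≤ 1 := by
      have := hs.inv_pow_anti (n := 0) (m := 10) (by norm_num); simpa using this
    have hsq : (700 * (K ^ 10)⁻¹) ^ 2 * T ≤ 49 * 10 ^ 6 * (K ^ 10)⁻¹ := by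
      calc (700 * (K ^ 10)⁻¹) ^ 2 * T ≤ (700 * (K ^ 10)⁻¹) ^ 2 * 100 := by gcongr
        _ = 49 * 10 ^ 6 * ((K ^ 10)⁻¹ * (K ^ 10)⁻¹) := by ring
        _ ≤ 49 * 10 ^ 6 * ((K ^ 10)⁻¹ * 1) := by gcongr
        _ = _ := by ring
    have hchain : (K ^ 10)⁻¹ ≤ 1 / 10 ^ 12 * K ^ (-(1 : ℝ) / 4) := by
      calc (K ^ 10)⁻¹ ≤ 1 / 10 ^ 6 * (K ^ 9)⁻¹ := h10
        _ ≤ 1 / 10 ^ 6 * (1 / 10 ^ 6 * (K ^ 8)⁻¹) := by gcongr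
        _ ≤ 1 / 10 ^ 6 * (1 / 10 ^ 6 * K ^ (-(1 : ℝ) / 4)) := by gcongr; exact h8.trans hq
        _ = _ := by ring
    nlinarith
  · have := hs.tc_lt_two; linarith

/-- **(6.151): `t_c ≥ 1/2`** (and hence `T > 1/2`, the source's (6.154)).
[cite: Tao2016AveragedNS, §6.7 (6.151), (6.154)] -/
theorem Setting.half_le_tc (hs : Setting ε₀ K ε C₁ C₂ C₃ C₄ C₅ n₀ N τ Y F T)
    (hex : ExitTrichotomy ε₀ K Y F T) : 1 / 2 ≤ tc K ε Y T := by
  have h1 := hs.min_le_tc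
  have h2 := hs.tc_lt_T hex
  rcases le_total T (1 / 2) with h | h
  · rw [min_eq_left h] at h1; linarith
  · rwa [min_eq_right h] at h1

/-- **(6.159): `c₀(t_c) = K⁻¹⁰ ε²`** (exit by equality, continuity, and positivity of `c₀` from
the ignition bound). [cite: Tao2016AveragedNS, §6.7 (6.159)] -/
theorem Setting.c_zero_tc (hs : Setting ε₀ K ε C₁ C₂ C₃ C₄ C₅ n₀ N τ Y F T)
    (hex : ExitTrichotomy ε₀ K Y F T) : Y 2 0 (tc K ε Y T) = (K ^ 10)⁻¹ * ε ^ 2 := by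
  have htc := hs.tc_mem
  have hlt := hs.tc_lt_T hex
  have hhalf := hs.half_le_tc hex
  have hP : ∀ s ∈ Icc 0 (tc K ε Y T), SmallC K ε Y s := fun s hs' => hs.smallC_of_mem_tc hs'
  have hsm := hP _ ⟨htc.1, le_rfl⟩
  unfold SmallC at hsm
  -- positivity
  have hpos : 0 < Y 2 0 (tc K ε Y T) := by
    have h := hs.c_zero_lower htc hP ⟨htc.1, le_rfl⟩ (by linarith)
    exact lt_of_lt_of_le (by have := hs.ε_pos; positivity) h
  -- not strictly inside
  have hge : (K ^ 10)⁻¹ * ε ^ 2 ≤ |Y 2 0 (tc K ε Y T)| := by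
    by_contra hlt'
    push Not at hlt'
    have hne := ODE.not_eventually_of_maximalTimeP_lt hs.T_nn hs.smallC_zero hlt
    apply hne
    have hcont : ContinuousWithinAt (fun u => |Y 2 0 u|) (Icc 0 T) (tc K ε Y T) :=
      ((hs.continuousOn_Y 2 0 (b := T) hs.τ₀_le).abs) _ htc
    have hev := Filter.Tendsto.eventually_lt_const hlt' hcont.tendsto
    exact hev.mono fun u hu => hu.le
  rw [abs_of_pos hpos] at hge hsm
  exact le_antisymm hsm hge

end Transition

end ZeroScale

end TaoCascade

end Literature.Analysis.FluidPDE
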